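import Literature.Analysis.FluidPDE.ChaeChoeCriterion
import HarnessLib

/-!
# Gradients of two velocity components in the critical class `L^α(0,T; L^γ)`, `2/α + 3/γ = 2`
# (Fan–Gao 2009, Lebesgue case), PROVED

search for candidate a priori estimates; no regularity claim (cell `pub-nsfunc`, literature seat:
a published continuation criterion as a THEOREM; nothing new).

J. Fan, H. Gao, *Two component regularity for the Navier–Stokes equations*, Electron. J.
Differential Equations 2009, No. 121, 1–6, Thm. 1.1: with `ũ = (u₁, u₂, 0)`, a Leray–Hopf
solution with `u₀ ∈ H¹` is strong on `[0, T]` if `∇ũ ∈ L^{2/(2−r)}(0,T; Ẋ_r)` (1.5) or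
`∇ũ ∈ L^{2/(1−r)}(0,T; Ẏ_{1+r})` (1.6) for some `r ∈ [0,1)` (multiplier spaces
`Ẋ_r = M(Ḣ^r, L²)`, `Ẏ_{1+r} = M(Ḣ^r, Ḣ^{−1})`), and Remark 1.2: "since `L^{3/r} ⊂ Ẋ_r` and
`L^{3/(1+r)} ⊂ Ẏ_{1+r}`, our results improve" Chae–Choe's Thm. 2 (`2/α + 3/γ ≤ 1`) to the
correct scaling. The Lebesgue case is the criterion
`∇ũ ∈ L^α(0,T; L^γ)`, `2/α + 3/γ = 2`, `3/2 < γ ≤ ∞`; explicitly, `γ ∈ (3, ∞]` is the Lebesgue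
case of (1.5) (`r = 3/γ ∈ [0,1)`, `L^{3/r} ⊂ Ẋ_r`, `Ẋ₀ = L^∞`) and `γ ∈ (3/2, 3]` that of (1.6)
(`1 + r = 3/γ`, `L^{3/(1+r)} ⊂ Ẏ_{1+r}`); this file proves the union `3/2 < γ ≤ ∞` in one chain
(referee F60.1). Its printed proof is the
gradient-enstrophy balance with the structural observation (following Bae–Choe 2007) that every
summand of `Σ ∂ₖuᵢ ∂ᵢuⱼ ∂ₖuⱼ` carries a factor from `∇ũ`, then Hölder, interpolation, Young and
Grönwall.

Rendering (that of the tree's `chaeChoe_two_vorticity_components_criterion`, ns.S27): a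
classical unforced solution on `ℝ³ × [0, T)` in the Beale–Kato–Majda class on every `[0, T'']`,
`T'' < T`; for an index `k` the gradients `∇u_j = e_j^* ∘ ∇u`, `j ≠ k`, of the two OTHER
velocity components lie in `L^α(0,T; L^γ)` (operator norm of the covector), `2/α + 3/γ = 2`,
`1 < α < ∞` (`⇔ 3/2 < γ < ∞`); conclusion `HasSobolevExtensionPast ν u T`. We use the VORTICITY
balance (the tree's slab Grönwall `integral_sq_norm_curl_le_mul_exp_of_weight_slab_ae`, as for
Chae–Choe's Thm. 1) instead of the gradient balance of the paper; the structural observation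
becomes the pointwise bound `abs_inner_curlCLM_apply_le_two_rows` on `⟪ω, (∇u)ω⟫` (no trace
condition needed), and the analytic chain (Hölder, Calderón–Zygmund `‖∇u‖_m ≤ C‖ω‖_m`,
interpolation `2`–`6`, Sobolev, Young) is that of `ChaeChoeStretchingEstimate.lean`.

* `abs_inner_curlCLM_apply_le_two_rows` — the pointwise structure;
* `exists_two_mul_integral_stretching_le_of_two_velocity_gradients` — the fixed-time estimate;
* `exists_uniform_H1_bound_of_two_velocity_gradients` — the a priori `H¹` bound;
* `fanGao_two_velocity_gradients_criterion` — **the criterion** (`2/α + 3/γ = 2`);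
* `fanGao_two_velocity_gradients_criterion_of_le` — `2/α + 3/γ ≤ 2`, `α ≤ ∞` (Hölder in time);
* `two_mul_integral_stretching_le_of_two_velocity_gradients_top`,
  `fanGao_two_velocity_gradients_criterion_top` (`∇u_j ∈ L¹(0,T; L^∞)`, the case `r = 0` of
  (1.5): `Ẋ₀ = L^∞`), `…_top_of_le` (`L^α(0,T; L^∞)`, `1 ≤ α ≤ ∞`).

## References

* J. Fan, H. Gao, Electron. J. Differential Equations 2009 (2009), No. 121, 1–6: Thm. 1.1,
  Remark 1.2 and the proof (3.1)–(3.2) (open access; text read, pp. 1–4). [FanGao2009EJDE]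
* D. Chae, H.-J. Choe, Electron. J. Differential Equations 1999 (1999), No. 05: Thm. 2 (the
  `2/α + 3/γ ≤ 1` version) and the interpolation–Young step (8)–(9). [ChaeChoe1999]
* T. Tao, Anal. PDE 6 (2013), Lemma 8.1 (energy class). [Tao2011]
-/

noncomputable section

open MeasureTheory Set Function Filter Metric Real InnerProductSpace
open _root_.Topology
open scoped ENNReal NNReal RealInnerProductSpace ContDiff

namespace Literature.Analysis.FluidPDE

-- nested operator types (second derivatives)
set_option maxSynthPendingDepth 3

/-- A component is bounded by the vector: `|y k| ≤ ‖y‖`. [folklore] -/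
private theorem abs_apply_le_norm_fg (y : EuclideanSpace ℝ (Fin 3)) (k : Fin 3) : |y k| ≤ ‖y‖ := by
  have h := EuclideanSpace.norm_sq_eq y
  have hk : |y k| ^ 2 ≤ ∑ j, |y j| ^ 2 :=
    Finset.single_le_sum (f := fun j => |y j| ^ 2) (fun j _ => sq_nonneg _) (Finset.mem_univ k)
  have h2 : |y k| ^ 2 ≤ ‖y‖ ^ 2 := by
    rw [h]
    simpa only [Real.norm_eq_abs] using hk
  exact abs_le_of_sq_le_sq' (by nlinarith [norm_nonneg y, abs_nonneg (y k)]) (norm_nonneg _) |>.2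

/-- Exponent algebra (as in `ChaeChoeStretchingEstimate`): for `ρ > 3/2` and `m = 2ρ/(ρ-1)`,
`2 < m < 6`, `(ρ, m/2)` are Hölder conjugate, and the interpolation exponents between `L²` and
`L⁶` at `L^m`, multiplied by `2/m`, are `1 - 3/(2ρ)` and `1/(2ρ)`. [folklore] -/
private theorem fg_exponent_algebra {ρ : ℝ} (hρ : 3 / 2 < ρ) :
    let m : ℝ := 2 * ρ / (ρ - 1)
    2 < m ∧ m < 6 ∧ ρ.HolderConjugate (m / 2) ∧
      (6 - m) / (6 - 2) * (2 / m) = 1 - 3 / (2 * ρ) ∧ (m - 2) / (6 - 2) * (2 / m) = 1 / (2 * ρ) := by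
  intro m
  have hρ1 : 0 < ρ - 1 := by linarith
  have hρ0 : 0 < ρ := by linarith
  have hm : m = 2 * ρ / (ρ - 1) := rfl
  refine ⟨?_, ?_, ?_, ?_, ?_⟩
  · rw [hm, lt_div_iff₀ hρ1]; linarith
  · rw [hm, div_lt_iff₀ hρ1]; linarith
  · rw [Real.holderConjugate_iff]
    refine ⟨by linarith, ?_⟩
    rw [hm]; field_simp; ring
  · rw [hm]; field_simp; ring
  · rw [hm]; field_simp; ring

/-- `(3/2 : ℝ≥0∞) < γ < ∞` in real terms. [folklore] -/
private theorem toReal_three_halves_lt_fg {γ : ℝ≥0∞} (hγ : 3 / 2 < γ) (hγtop : γ ≠ ⊤) :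
    3 / 2 < γ.toReal := by
  have h : ((3 / 2 : ℝ≥0∞)).toReal < γ.toReal :=
    (ENNReal.toReal_lt_toReal (ENNReal.div_ne_top (by norm_num) (by norm_num)) hγtop).2 hγ
  have h32 : ((3 / 2 : ℝ≥0∞)).toReal = 3 / 2 := by
    rw [ENNReal.toReal_div, ENNReal.toReal_ofNat, ENNReal.toReal_ofNat]
  rw [h32] at h
  exact h

/-- Coordinates of the curl vector `curlCLM L`. [folklore] -/
private theorem curlCLM_apply_coord_vg (L : EuclideanSpace ℝ (Fin 3) →L[ℝ] EuclideanSpace ℝ (Fin 3)) :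
    curlCLM L 0 = L (EuclideanSpace.basisFun (Fin 3) ℝ 1) 2 - L (EuclideanSpace.basisFun (Fin 3) ℝ 2) 1 ∧
    curlCLM L 1 = L (EuclideanSpace.basisFun (Fin 3) ℝ 2) 0 - L (EuclideanSpace.basisFun (Fin 3) ℝ 0) 2 ∧
    curlCLM L 2 = L (EuclideanSpace.basisFun (Fin 3) ℝ 0) 1 - L (EuclideanSpace.basisFun (Fin 3) ℝ 1) 0 := by
  simp [curlCLM, curlLM, EuclideanSpace.basisFun_apply]

/-- `|(curl L)_k| ≤ ‖e_{k+1}^* ∘ L‖ + ‖e_{k+2}^* ∘ L‖`. [folklore] -/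
private theorem abs_curlCLM_apply_le (L : EuclideanSpace ℝ (Fin 3) →L[ℝ] EuclideanSpace ℝ (Fin 3))
    (k : Fin 3) :
    |curlCLM L k| ≤ ‖(EuclideanSpace.proj (k + 1) : EuclideanSpace ℝ (Fin 3) →L[ℝ] ℝ).comp L‖ +
      ‖(EuclideanSpace.proj (k + 2) : EuclideanSpace ℝ (Fin 3) →L[ℝ] ℝ).comp L‖ := by
  obtain ⟨h0, h1, h2⟩ := curlCLM_apply_coord_vg L
  have hG : ∀ (a b : Fin 3), |L (EuclideanSpace.basisFun (Fin 3) ℝ a) b| ≤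
      ‖(EuclideanSpace.proj b : EuclideanSpace ℝ (Fin 3) →L[ℝ] ℝ).comp L‖ := by
    intro a b
    have h := ((EuclideanSpace.proj b : EuclideanSpace ℝ (Fin 3) →L[ℝ] ℝ).comp L).le_opNorm
      (EuclideanSpace.basisFun (Fin 3) ℝ a)
    simpa [Real.norm_eq_abs] using h
  fin_cases k
  · simp only [Fin.zero_eta, Fin.isValue, zero_add]
    rw [h0]
    exact (abs_sub _ _).trans (by linarith [hG 1 2, hG 2 1])
  · simp only [Fin.mk_one, Fin.isValue]
    rw [show (1 : Fin 3) + 1 = 2 from rfl, show (1 : Fin 3) + 2 = 0 from rfl, h1]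
    exact (abs_sub _ _).trans (by linarith [hG 2 0, hG 0 2])
  · simp only [Fin.reduceFinMk, Fin.isValue]
    rw [show (2 : Fin 3) + 1 = 0 from rfl, show (2 : Fin 3) + 2 = 1 from rfl, h2]
    exact (abs_sub _ _).trans (by linarith [hG 0 1, hG 1 0])

/-- `⟪w, z⟫ = Σ` over the three indices `k, k+1, k+2`. [folklore] -/
private theorem inner_eq_sum_three_vg (w z : EuclideanSpace ℝ (Fin 3)) (k : Fin 3) :
    ⟪w, z⟫ = w k * z k + w (k + 1) * z (k + 1) + w (k + 2) * z (k + 2) := by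
  rw [EuclideanSpace.inner_eq_star_dotProduct]
  fin_cases k <;> simp [dotProduct, Fin.sum_univ_three] <;> ring

/-- **The structure of the vorticity stretching with respect to two velocity components**
(Bae–Choe / Fan–Gao: "we consider separately the three cases `i ≠ 3`; `i = 3` and `j ≠ 3`;
`i = j = 3` … every term carries a factor from `∇ũ`", here in vorticity form): for every linear
`L : ℝ³ → ℝ³` with curl vector `w = curl L` and row covectors `∇v_j = e_j^* ∘ L`,
`|⟪w, L w⟫| ≤ (‖∇v_{k+1}‖ + ‖∇v_{k+2}‖)(‖L‖ |w| + |w|²)` — the `k`-th component of the curl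
only involves the rows `k+1, k+2`, and `(Lw)_j = ∇v_j · w`. No trace condition is needed.
[cite: FanGao2009EJDE, proof of Thm. 1.1, (3.1) (p. 3–4)] -/
theorem abs_inner_curlCLM_apply_le_two_rows (L : EuclideanSpace ℝ (Fin 3) →L[ℝ] EuclideanSpace ℝ (Fin 3))
    (k : Fin 3) :
    |⟪curlCLM L, L (curlCLM L)⟫| ≤
      (‖(EuclideanSpace.proj (k + 1) : EuclideanSpace ℝ (Fin 3) →L[ℝ] ℝ).comp L‖ +
        ‖(EuclideanSpace.proj (k + 2) : EuclideanSpace ℝ (Fin 3) →L[ℝ] ℝ).comp L‖) *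
        (‖L‖ * ‖curlCLM L‖ + ‖curlCLM L‖ ^ 2) := by
  set w := curlCLM L with hw
  set G : Fin 3 → (EuclideanSpace ℝ (Fin 3) →L[ℝ] ℝ) := fun j =>
    (EuclideanSpace.proj j : EuclideanSpace ℝ (Fin 3) →L[ℝ] ℝ).comp L with hGdef
  have hGw : ∀ j, (L w) j = G j w := fun j => rfl
  have hGle : ∀ j, |(L w) j| ≤ ‖G j‖ * ‖w‖ := fun j => by
    rw [hGw, ← Real.norm_eq_abs]; exact (G j).le_opNorm w
  have hcomp : ∀ j, |w j| ≤ ‖w‖ := fun j => by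
    have h := EuclideanSpace.norm_sq_eq w
    have hk : |w j| ^ 2 ≤ ∑ i, |w i| ^ 2 :=
      Finset.single_le_sum (f := fun i => |w i| ^ 2) (fun i _ => sq_nonneg _) (Finset.mem_univ j)
    have h2 : |w j| ^ 2 ≤ ‖w‖ ^ 2 := by rw [h]; simpa only [Real.norm_eq_abs] using hk
    exact abs_le_of_sq_le_sq' (by nlinarith [norm_nonneg w, abs_nonneg (w j)]) (norm_nonneg _) |>.2
  have hwk : |w k| ≤ ‖G (k + 1)‖ + ‖G (k + 2)‖ := abs_curlCLM_apply_le L k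
  have hcompL : ∀ j, |(L w) j| ≤ ‖L w‖ := fun j => by
    have h := EuclideanSpace.norm_sq_eq (L w)
    have hk : |(L w) j| ^ 2 ≤ ∑ i, |(L w) i| ^ 2 :=
      Finset.single_le_sum (f := fun i => |(L w) i| ^ 2) (fun i _ => sq_nonneg _) (Finset.mem_univ j)
    have h2 : |(L w) j| ^ 2 ≤ ‖L w‖ ^ 2 := by rw [h]; simpa only [Real.norm_eq_abs] using hk
    exact abs_le_of_sq_le_sq' (by nlinarith [norm_nonneg (L w), abs_nonneg ((L w) j)]) (norm_nonneg _) |>.2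
  have hLw : ∀ j, |(L w) j| ≤ ‖L‖ * ‖w‖ := fun j => (hcompL j).trans (L.le_opNorm w)
  have hG0 : ∀ j, 0 ≤ ‖G j‖ := fun j => norm_nonneg _
  rw [inner_eq_sum_three_vg w (L w) k]
  have t0 : |w k * (L w) k| ≤ (‖G (k + 1)‖ + ‖G (k + 2)‖) * (‖L‖ * ‖w‖) := by
    rw [abs_mul]; exact mul_le_mul hwk (hLw k) (abs_nonneg _) (by positivity)
  have t1 : |w (k + 1) * (L w) (k + 1)| ≤ ‖w‖ * (‖G (k + 1)‖ * ‖w‖) := by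
    rw [abs_mul]; exact mul_le_mul (hcomp _) (hGle _) (abs_nonneg _) (norm_nonneg _)
  have t2 : |w (k + 2) * (L w) (k + 2)| ≤ ‖w‖ * (‖G (k + 2)‖ * ‖w‖) := by
    rw [abs_mul]; exact mul_le_mul (hcomp _) (hGle _) (abs_nonneg _) (norm_nonneg _)
  have htri : |w k * (L w) k + w (k + 1) * (L w) (k + 1) + w (k + 2) * (L w) (k + 2)| ≤
      |w k * (L w) k| + |w (k + 1) * (L w) (k + 1)| + |w (k + 2) * (L w) (k + 2)| :=
    (abs_add_le _ _).trans (add_le_add (abs_add_le _ _) le_rfl)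
  have hexp : (‖G (k + 1)‖ + ‖G (k + 2)‖) * (‖L‖ * ‖w‖ + ‖w‖ ^ 2) =
      (‖G (k + 1)‖ + ‖G (k + 2)‖) * (‖L‖ * ‖w‖) + ‖w‖ * (‖G (k + 1)‖ * ‖w‖) +
        ‖w‖ * (‖G (k + 2)‖ * ‖w‖) := by ring
  rw [hexp]
  linarith [t0, t1, t2, htri]


set_option maxHeartbeats 1600000 in
/-- **The stretching estimate with two velocity-component gradients as weight** (the
Lebesgue-space case of Fan–Gao 2009, proof of Thm. 1.1: with `ũ = (u₁, u₂, 0)`,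
"`½ d/dt ∫|∇u|² + ∫|∇²u|² = Σ ∫∂ₖuᵢ ∂ᵢuⱼ ∂ₖuⱼ ≤ 2∫|∇ũ| |∇u|² =: I`" (every summand carries a
factor from `∇ũ`, following Bae–Choe), then Hölder, the interpolation inequality and Young:
`I ≤ ε‖∇²u‖²₂ + C‖∇ũ‖_{X}^{2/(2−r)}‖∇u‖²₂`; here `X = L^γ`, and the vorticity form of the
balance is used, with the pointwise structure `abs_inner_curlCLM_apply_le_two_rows`). For
`3/2 < γ < ∞`, `ν > 0` and an index `k` there is `C = C(γ, ν) ≥ 0` such that every `C^∞`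
divergence-free field `v` on `ℝ³` with `v ∈ L² ∩ L^∞`, `∇v` bounded, `∇v, ∇²v ∈ L²` and
`∇v_{k+1}, ∇v_{k+2} ∈ L^γ` (`∇v_j = e_j^* ∘ ∇v`) satisfies, with `ω = curl v`,
`2∫⟪ω, (∇v)ω⟫ ≤ ν ∫|∇ω|²_F + C (‖∇v_{k+1}‖_γ^q + ‖∇v_{k+2}‖_γ^q) ∫|ω|²`, `q = 2γ/(2γ−3)`
(`2/q + 3/γ = 2`): Hölder (`γ`, `m/2`), `m = 2γ/(γ−1)`, and Cauchy–Schwarz, the tree's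
Calderón–Zygmund bound `‖∇v‖_m ≤ C₁‖ω‖_m`, Lebesgue interpolation `2`–`6`, Sobolev
`‖ω‖₆ ≤ K‖∇ω‖₂`, Young with exponents `1/θ`, `1/(1−θ)`, `θ = 1 − 3/(2γ)`, and
`(a+b)^q ≤ 2^{q−1}(a^q + b^q)`. The constant is not a printed one.
[cite: FanGao2009EJDE, Thm. 1.1 and its proof, (3.1)–(3.2) with Remark 1.2 (pp. 2–4); ChaeChoe1999, proof of Thm. 1, (8)–(9) (the interpolation–Young step)] -/
theorem exists_two_mul_integral_stretching_le_of_two_velocity_gradients {γ : ℝ≥0∞} (hγ : 3 / 2 < γ)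
    (hγtop : γ ≠ ⊤) {ν : ℝ} (hν : 0 < ν) (k : Fin 3) :
    ∃ C : ℝ, 0 ≤ C ∧ ∀ v : EuclideanSpace ℝ (Fin 3) → EuclideanSpace ℝ (Fin 3), ContDiff ℝ ∞ v →
      VectorCalculus.IsDivFree v → eLpNorm v 2 volume < ⊤ → eLpNorm v ⊤ volume < ⊤ →
      ∀ {B₁ : ℝ}, (∀ x, ‖fderiv ℝ v x‖ ≤ B₁) →
      (∫⁻ x, ‖iteratedFDeriv ℝ 1 v x‖ₑ ^ 2 < ⊤) → (∫⁻ x, ‖iteratedFDeriv ℝ 2 v x‖ₑ ^ 2 < ⊤) →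
      eLpNorm (fun x => (EuclideanSpace.proj (k + 1) : EuclideanSpace ℝ (Fin 3) →L[ℝ] ℝ).comp (fderiv ℝ v x)) γ volume < ⊤ →
      eLpNorm (fun x => (EuclideanSpace.proj (k + 2) : EuclideanSpace ℝ (Fin 3) →L[ℝ] ℝ).comp (fderiv ℝ v x)) γ volume < ⊤ →
        2 * ∫ x, ⟪curl v x, fderiv ℝ v x (curl v x)⟫ ≤
          ν * (∫ x, frobeniusNormSq (fderiv ℝ (curl v) x)) +
            C * ((eLpNorm (fun x => (EuclideanSpace.proj (k + 1) : EuclideanSpace ℝ (Fin 3) →L[ℝ] ℝ).comp (fderiv ℝ v x)) γ volume).toReal ^ (1 / (1 - 3 / (2 * γ.toReal))) +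
                (eLpNorm (fun x => (EuclideanSpace.proj (k + 2) : EuclideanSpace ℝ (Fin 3) →L[ℝ] ℝ).comp (fderiv ℝ v x)) γ volume).toReal ^ (1 / (1 - 3 / (2 * γ.toReal)))) *
              ∫ x, ‖curl v x‖ ^ 2 := by
  set e := EuclideanSpace.basisFun (Fin 3) ℝ with he
  have he1 : ∀ i, ‖e i‖ = 1 := fun i => by simp [he]
  set K : ℝ≥0 := SNormLESNormFDerivOfEqConst (EuclideanSpace ℝ (Fin 3))
    (volume : Measure (EuclideanSpace ℝ (Fin 3))) 2 with hK
  -- the real exponents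
  have hγ0 : γ ≠ 0 := (lt_trans (by norm_num) hγ).ne'
  set ρ : ℝ := γ.toReal with hρ
  have hρ3 : 3 / 2 < ρ := toReal_three_halves_lt_fg hγ hγtop
  have hρ0 : 0 < ρ := by linarith
  obtain ⟨h2m, hm6, hconj, hexpθ, hexp1⟩ := fg_exponent_algebra hρ3
  set m : ℝ := 2 * ρ / (ρ - 1) with hm
  have hm0 : 0 < m := by linarith
  set θ : ℝ := 1 - 3 / (2 * ρ) with hθ
  have hθ0 : 0 < θ := by
    rw [hθ, sub_pos, div_lt_one (by positivity)]; linarith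
  have hθ1 : θ < 1 := by
    rw [hθ]; linarith [div_pos (zero_lt_three' ℝ) (by positivity : (0 : ℝ) < 2 * ρ)]
  have h1θ : 0 ≤ 1 - θ := by linarith
  -- the exponent `m` as an `ℝ≥0∞`
  set mE : ℝ≥0∞ := ENNReal.ofReal m with hmE
  have hmEr : mE.toReal = m := ENNReal.toReal_ofReal hm0.le
  have h1mE : 1 < mE := by
    rw [hmE, ← ENNReal.ofReal_one]; exact (ENNReal.ofReal_lt_ofReal_iff hm0).2 (by linarith)
  have hmE6 : mE ≤ 6 := by
    rw [hmE, show (6 : ℝ≥0∞) = ENNReal.ofReal 6 by norm_num]; exact ENNReal.ofReal_le_ofReal hm6.le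
  have hgap : 3 * (1 / mE.toReal - 1 / (6 : ℝ≥0∞).toReal) < 1 := by
    rw [hmEr, ENNReal.toReal_ofNat]
    have : 1 / m < 1 / 2 := by
      rw [div_lt_div_iff₀ hm0 (by norm_num)]; linarith
    linarith
  -- the constants
  obtain ⟨C₁, hC₁⟩ := exists_eLpNorm_fderiv_le_curl_of_isDivFree_of_eLpNorm_lt_top
    (p := mE) (s := 6) h1mE hmE6 (by norm_num) hgap
  set Aw : ℝ≥0 := C₁ + 1 with hAw
  set c₀ : ℝ := θ * (2 * (1 - θ)) ^ ((1 - θ) / θ) * ν ^ (-((1 - θ) / θ)) with hc₀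
  have hc₀0 : 0 ≤ c₀ := by
    rw [hc₀]
    have : 0 ≤ ν ^ (-((1 - θ) / θ)) := Real.rpow_nonneg hν.le _
    positivity
  set C : ℝ := 2 * c₀ * ((Aw : ℝ) * (K : ℝ) ^ (2 * (1 - θ))) ^ (1 / θ) * (2 : ℝ) ^ (1 / θ - 1)
    with hCdef
  have hC0 : 0 ≤ C := by rw [hCdef]; positivity
  refine ⟨C, hC0, ?_⟩
  intro v hv hdiv hv2 hvtop B₁ hB₁ hv1 hv2' hN1 hN2
  -- the vorticity and its regularity
  have hv3 : ContDiff ℝ 3 v := hv.of_le (by norm_cast)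
  have hvm : AEStronglyMeasurable v volume := hv.continuous.aestronglyMeasurable
  set om : EuclideanSpace ℝ (Fin 3) → EuclideanSpace ℝ (Fin 3) := curl v with homdef
  have hom : ContDiff ℝ ∞ om := contDiff_curl (n := ⊤) (hv.of_le (by exact_mod_cast le_top))
  have hom1 : ContDiff ℝ 1 om := hom.of_le (by norm_cast)
  have cω : Continuous om := hom.continuous
  have cDv : Continuous (fderiv ℝ v) := hv.continuous_fderiv (by simp)
  have cDω : Continuous (fderiv ℝ om) := hom.continuous_fderiv (by simp)
  set G : Fin 3 → EuclideanSpace ℝ (Fin 3) → (EuclideanSpace ℝ (Fin 3) →L[ℝ] ℝ) := fun j x =>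
    (EuclideanSpace.proj j : EuclideanSpace ℝ (Fin 3) →L[ℝ] ℝ).comp (fderiv ℝ v x) with hGdef
  have cG : ∀ j, Continuous (G j) := fun j => continuous_const.clm_comp cDv
  have hGle : ∀ j x, ‖G j x‖ ≤ ‖fderiv ℝ v x‖ := by
    intro j x
    refine ContinuousLinearMap.opNorm_le_bound _ (norm_nonneg _) fun y => ?_
    rw [hGdef]
    dsimp only
    rw [ContinuousLinearMap.comp_apply, Real.norm_eq_abs]
    exact (abs_apply_le_norm_fg _ j).trans ((fderiv ℝ v x).le_opNorm y)
  have hB₁0 : 0 ≤ B₁ := (norm_nonneg _).trans (hB₁ 0)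
  -- `ω, ∇ω ∈ L²`
  set κ : ℝ := ‖curlCLM‖ with hκ
  have l2ω : ∫⁻ x, ‖om x‖ₑ ^ 2 < ⊤ :=
    lt_of_le_of_lt (lintegral_curl_sq_le v) (ENNReal.mul_lt_top ENNReal.ofReal_lt_top hv1)
  have l2Dω : ∫⁻ x, ‖fderiv ℝ om x‖ₑ ^ 2 < ⊤ := by
    have hle : ∀ x, ‖fderiv ℝ om x‖ ≤ ‖κ • iteratedFDeriv ℝ 2 v x‖ := fun x => by
      rw [norm_smul, Real.norm_of_nonneg (norm_nonneg curlCLM)]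
      have h1 : ‖fderiv ℝ om x‖ = ‖iteratedFDeriv ℝ 1 om x‖ := by
        rw [← norm_iteratedFDeriv_fderiv, norm_iteratedFDeriv_zero]
      rw [h1, homdef]
      exact norm_iteratedFDeriv_curl_le_opNorm_mul hv3 1 (by norm_num) x
    refine lintegral_enorm_sq_lt_top_of_norm_le hle ?_
    have h2 : ∫⁻ x, ‖κ • iteratedFDeriv ℝ 2 v x‖ₑ ^ 2 = ‖κ‖ₑ ^ 2 * ∫⁻ x, ‖iteratedFDeriv ℝ 2 v x‖ₑ ^ 2 := by
      rw [← lintegral_const_mul' _ _ (by simp)]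
      exact lintegral_congr fun x => by rw [enorm_smul, mul_pow]
    rw [h2]
    exact ENNReal.mul_lt_top (by simp) hv2'
  -- the real quantities `a = ∫|ω|²`, `R = ∫|∇ω|²_F`
  have i_a : Integrable (fun x => ‖om x‖ ^ 2) volume := integrable_sq_norm_of_lintegral_lt_top cω l2ω
  set a : ℝ := ∫ x, ‖om x‖ ^ 2 with ha
  have ha0 : 0 ≤ a := integral_nonneg fun x => sq_nonneg _
  have hRlt : ∫⁻ x, ENNReal.ofReal (frobeniusNormSq (fderiv ℝ om x)) < ⊤ := by
    calc ∫⁻ x, ENNReal.ofReal (frobeniusNormSq (fderiv ℝ om x))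
        ≤ ∫⁻ x, 3 * ‖fderiv ℝ om x‖ₑ ^ 2 :=
          lintegral_mono fun x => ofReal_frobeniusNormSq_le_three_mul_enorm_sq _
      _ = 3 * ∫⁻ x, ‖fderiv ℝ om x‖ₑ ^ 2 := lintegral_const_mul' _ _ (by norm_num)
      _ < ⊤ := ENNReal.mul_lt_top (by norm_num) l2Dω
  have i_R : Integrable (fun x => frobeniusNormSq (fderiv ℝ om x)) volume :=
    integrable_of_continuous_of_nonneg (continuous_frobeniusNormSq_fderiv hom1 (by simp))
      (fun x => frobeniusNormSq_nonneg _) hRlt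
  set R : ℝ := ∫ x, frobeniusNormSq (fderiv ℝ om x) with hR
  have hR0 : 0 ≤ R := integral_nonneg fun x => frobeniusNormSq_nonneg _
  have hRE : ENNReal.ofReal R = ∫⁻ x, ENNReal.ofReal (frobeniusNormSq (fderiv ℝ om x)) :=
    ofReal_integral_eq_lintegral_ofReal i_R (Eventually.of_forall fun x => frobeniusNormSq_nonneg _)
  have hD : eLpNorm (fderiv ℝ om) 2 volume ^ 2 ≤ ENNReal.ofReal R := by
    rw [← lintegral_enorm_sq_eq_eLpNorm_two_sq, hRE]
    refine lintegral_mono fun x => ?_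
    rw [← ofReal_norm, ← ENNReal.ofReal_pow (norm_nonneg _)]
    exact ENNReal.ofReal_le_ofReal (sq_opNorm_le_frobeniusNormSq _)
  -- the two controlled vorticity components
  set N₁ : ℝ≥0 := (eLpNorm (G (k + 1)) γ volume).toNNReal with hN₁
  set N₂ : ℝ≥0 := (eLpNorm (G (k + 2)) γ volume).toNNReal with hN₂
  have hN₁E : ((N₁ : ℝ≥0) : ℝ≥0∞) = eLpNorm (G (k + 1)) γ volume := ENNReal.coe_toNNReal hN1.ne
  have hN₂E : ((N₂ : ℝ≥0) : ℝ≥0∞) = eLpNorm (G (k + 2)) γ volume := ENNReal.coe_toNNReal hN2.ne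
  have hN₁R : (eLpNorm (G (k + 1)) γ volume).toReal = (N₁ : ℝ) := rfl
  have hN₂R : (eLpNorm (G (k + 2)) γ volume).toReal = (N₂ : ℝ) := rfl
  -- the pointwise structure bound and the majorant `g`
  set g : EuclideanSpace ℝ (Fin 3) → ℝ := fun x =>
    (‖G (k + 1) x‖ + ‖G (k + 2) x‖) * (‖fderiv ℝ v x‖ * ‖om x‖ + ‖om x‖ ^ 2) with hg
  have hg0 : ∀ x, 0 ≤ g x := fun x => by positivity
  have hSg : ∀ x, ⟪om x, fderiv ℝ v x (om x)⟫ ≤ g x := fun x =>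
    (le_abs_self _).trans (abs_inner_curlCLM_apply_le_two_rows (fderiv ℝ v x) k)
  have hgm : AEStronglyMeasurable g volume :=
    ((((cG _).norm).add ((cG _).norm)).mul ((cDv.norm.mul cω.norm).add (cω.norm.pow 2))).aestronglyMeasurable
  have l2Dv : ∫⁻ x, ‖fderiv ℝ v x‖ₑ ^ 2 < ⊤ := by
    refine lt_of_le_of_lt (le_of_eq (lintegral_congr fun x => ?_)) hv1
    rw [← ofReal_norm, ← ofReal_norm, norm_iteratedFDeriv_one v]
  have i_D : Integrable (fun x => ‖fderiv ℝ v x‖ ^ 2) volume := integrable_sq_norm_of_lintegral_lt_top cDv l2Dv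
  have i_g : Integrable g volume := by
    have hdom : Integrable (fun x => 2 * B₁ * (κ + κ ^ 2) * ‖fderiv ℝ v x‖ ^ 2) volume := i_D.const_mul _
    refine hdom.mono' hgm (Eventually.of_forall fun x => ?_)
    rw [Real.norm_of_nonneg (hg0 x), hg]
    dsimp only
    have h1 : ‖G (k + 1) x‖ ≤ B₁ := (hGle _ x).trans (hB₁ x)
    have h2 : ‖G (k + 2) x‖ ≤ B₁ := (hGle _ x).trans (hB₁ x)
    have h3 : ‖om x‖ ≤ κ * ‖fderiv ℝ v x‖ := norm_curl_le v x
    have hκ0 : 0 ≤ κ := norm_nonneg _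
    have hD0 : 0 ≤ ‖fderiv ℝ v x‖ := norm_nonneg _
    have hw0 : 0 ≤ ‖om x‖ := norm_nonneg _
    calc (‖G (k + 1) x‖ + ‖G (k + 2) x‖) * (‖fderiv ℝ v x‖ * ‖om x‖ + ‖om x‖ ^ 2)
        ≤ (B₁ + B₁) * (‖fderiv ℝ v x‖ * (κ * ‖fderiv ℝ v x‖) + (κ * ‖fderiv ℝ v x‖) ^ 2) := by
          gcongr
      _ = 2 * B₁ * (κ + κ ^ 2) * ‖fderiv ℝ v x‖ ^ 2 := by ring
  have hSle : ∫ x, ⟪om x, fderiv ℝ v x (om x)⟫ ≤ ∫ x, g x := by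
    by_cases hS : Integrable (fun x => ⟪om x, fderiv ℝ v x (om x)⟫) volume
    · exact integral_mono hS i_g hSg
    · rw [integral_undef hS]; exact integral_nonneg hg0
  -- `ℝ≥0∞` form of `∫ g`
  set Wm : ℝ≥0∞ := (∫⁻ x, ‖om x‖ₑ ^ m) ^ (1 / m) with hWm
  set Wm2 : ℝ≥0∞ := (∫⁻ x, ‖om x‖ₑ ^ m) ^ (2 / m) with hWm2
  set Dm : ℝ≥0∞ := (∫⁻ x, ‖fderiv ℝ v x‖ₑ ^ m) ^ (1 / m) with hDm
  have hWmsq : Wm * Wm = Wm2 := by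
    rw [hWm, hWm2, ← sq, ← ENNReal.rpow_two, ← ENNReal.rpow_mul]
    congr 1; field_simp
  have hpt : ∀ x, ENNReal.ofReal (g x) =
      (‖G (k + 1) x‖ₑ + ‖G (k + 2) x‖ₑ) * (‖fderiv ℝ v x‖ₑ * ‖om x‖ₑ + ‖om x‖ₑ ^ (2 : ℝ)) := by
    intro x
    rw [hg]
    dsimp only
    rw [ENNReal.ofReal_mul (by positivity), ENNReal.ofReal_add (norm_nonneg _) (norm_nonneg _),
      ENNReal.ofReal_add (by positivity) (by positivity), ENNReal.ofReal_mul (norm_nonneg _),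
      ENNReal.ofReal_pow (norm_nonneg _)]
    simp only [ofReal_norm, ENNReal.rpow_two]
  have mω : AEMeasurable (fun x => ‖om x‖ₑ) volume := cω.aemeasurable.enorm
  have mDv : AEMeasurable (fun x => ‖fderiv ℝ v x‖ₑ) volume := cDv.aemeasurable.enorm
  have mG : ∀ j, AEMeasurable (fun x => ‖G j x‖ₑ) volume := fun j => (cG j).aemeasurable.enorm
  -- Hölder for the off-diagonal group: `∫ |ω_j| |ω| |Dv| ≤ ‖ω_j‖_γ ‖ω‖_m ‖Dv‖_m`
  have h22 : (2 : ℝ).HolderConjugate 2 := by rw [Real.holderConjugate_iff]; norm_num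
  have hCS : (∫⁻ x, (‖om x‖ₑ * ‖fderiv ℝ v x‖ₑ) ^ (m / 2)) ^ (2 / m) ≤ Wm * Dm := by
    have hmul : ∀ x, (‖om x‖ₑ * ‖fderiv ℝ v x‖ₑ) ^ (m / 2) =
        ‖om x‖ₑ ^ (m / 2) * ‖fderiv ℝ v x‖ₑ ^ (m / 2) := fun x =>
      ENNReal.mul_rpow_of_nonneg _ _ (by positivity)
    have hpow : ∀ y : ℝ≥0∞, (y ^ (m / 2)) ^ (2 : ℝ) = y ^ m := fun y => by
      rw [← ENNReal.rpow_mul]; congr 1; ring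
    have hcs := ENNReal.lintegral_mul_le_Lp_mul_Lq volume h22
      (f := fun x => ‖om x‖ₑ ^ (m / 2)) (g := fun x => ‖fderiv ℝ v x‖ₑ ^ (m / 2))
      (mω.pow_const _) (mDv.pow_const _)
    simp only [Pi.mul_apply, hpow] at hcs
    calc (∫⁻ x, (‖om x‖ₑ * ‖fderiv ℝ v x‖ₑ) ^ (m / 2)) ^ (2 / m)
        = (∫⁻ x, ‖om x‖ₑ ^ (m / 2) * ‖fderiv ℝ v x‖ₑ ^ (m / 2)) ^ (2 / m) := by
          rw [lintegral_congr fun x => hmul x]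
      _ ≤ ((∫⁻ x, ‖om x‖ₑ ^ m) ^ (1 / (2 : ℝ)) * (∫⁻ x, ‖fderiv ℝ v x‖ₑ ^ m) ^ (1 / (2 : ℝ))) ^ (2 / m) := by
          gcongr
      _ = Wm * Dm := by
          rw [ENNReal.mul_rpow_of_nonneg _ _ (by positivity), ← ENNReal.rpow_mul, ← ENNReal.rpow_mul,
            hWm, hDm]
          congr 2 <;> field_simp
  have hT1 : ∀ j, ∫⁻ x, ‖G j x‖ₑ * (‖om x‖ₑ * ‖fderiv ℝ v x‖ₑ) ≤
      eLpNorm (G j) γ volume * (Wm * Dm) := by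
    intro j
    have h := ENNReal.lintegral_mul_le_Lp_mul_Lq volume hconj (f := fun x => ‖G j x‖ₑ)
      (g := fun x => ‖om x‖ₑ * ‖fderiv ℝ v x‖ₑ) (mG j) (mω.mul mDv)
    simp only [Pi.mul_apply] at h
    have hf : (∫⁻ x, ‖G j x‖ₑ ^ ρ) ^ (1 / ρ) = eLpNorm (G j) γ volume := by
      rw [eLpNorm_eq_lintegral_rpow_enorm_toReal hγ0 hγtop, ← hρ]
    have e2 : 1 / (m / 2) = 2 / m := by field_simp
    rw [hf, e2] at h
    exact h.trans (mul_le_mul' le_rfl hCS)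
  -- Hölder for the `|ω|²` group: `∫ |∇v_j| |ω|² ≤ ‖∇v_j‖_γ ‖ω‖_m²`
  have hT2 : ∀ j, ∫⁻ x, ‖G j x‖ₑ * ‖om x‖ₑ ^ (2 : ℝ) ≤ eLpNorm (G j) γ volume * Wm2 := by
    intro j
    have h := ENNReal.lintegral_mul_le_Lp_mul_Lq volume hconj
      (f := fun x => ‖G j x‖ₑ) (g := fun x => ‖om x‖ₑ ^ (2 : ℝ)) (mG j) (mω.pow_const _)
    have hgm' : ∀ x, (‖om x‖ₑ ^ (2 : ℝ)) ^ (m / 2) = ‖om x‖ₑ ^ m := fun x => by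
      rw [← ENNReal.rpow_mul]; congr 1; field_simp
    simp only [Pi.mul_apply, hgm'] at h
    have hf : (∫⁻ x, ‖G j x‖ₑ ^ ρ) ^ (1 / ρ) = eLpNorm (G j) γ volume := by
      rw [eLpNorm_eq_lintegral_rpow_enorm_toReal hγ0 hγtop, ← hρ]
    have e2 : 1 / (m / 2) = 2 / m := by field_simp
    rw [hf, e2] at h
    exact h
  -- the Calderón–Zygmund inputs
  have hv6 : eLpNorm v 6 volume < ⊤ :=
    (memLp_of_memLp_of_memLp_top (p := 2) (q := 6) (by norm_num) (by norm_num) ⟨hvm, hv2⟩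
      ⟨hvm, hvtop⟩).eLpNorm_lt_top
  have hmE0 : mE ≠ 0 := (lt_trans zero_lt_one h1mE).ne'
  have hmEtop : mE ≠ ⊤ := ENNReal.ofReal_ne_top
  have hDm_le : Dm ≤ C₁ * Wm := by
    have h := hC₁ v hv hdiv hv6
    rw [eLpNorm_eq_lintegral_rpow_enorm_toReal hmE0 hmEtop,
      eLpNorm_eq_lintegral_rpow_enorm_toReal hmE0 hmEtop, hmEr, ← homdef] at h
    exact h
  -- the bound for `∫ g` in `ℝ≥0∞`
  have hsum : ENNReal.ofReal (∫ x, g x) ≤ (Aw : ℝ≥0∞) * ((N₁ : ℝ≥0∞) + N₂) * Wm2 := by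
    rw [ofReal_integral_eq_lintegral_ofReal i_g (Eventually.of_forall hg0)]
    have hsplit : ∀ x, ENNReal.ofReal (g x) =
        (‖G (k + 1) x‖ₑ * (‖om x‖ₑ * ‖fderiv ℝ v x‖ₑ) + ‖G (k + 2) x‖ₑ * (‖om x‖ₑ * ‖fderiv ℝ v x‖ₑ)) +
          (‖G (k + 1) x‖ₑ * ‖om x‖ₑ ^ (2 : ℝ) + ‖G (k + 2) x‖ₑ * ‖om x‖ₑ ^ (2 : ℝ)) := fun x => by
      rw [hpt x]; ring
    have m1 : AEMeasurable (fun x => ‖G (k + 1) x‖ₑ * (‖om x‖ₑ * ‖fderiv ℝ v x‖ₑ)) volume :=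
      (mG _).mul (mω.mul mDv)
    have m2 : AEMeasurable (fun x => ‖G (k + 2) x‖ₑ * (‖om x‖ₑ * ‖fderiv ℝ v x‖ₑ)) volume :=
      (mG _).mul (mω.mul mDv)
    have m3 : AEMeasurable (fun x => ‖G (k + 1) x‖ₑ * ‖om x‖ₑ ^ (2 : ℝ)) volume :=
      (mG _).mul (mω.pow_const _)
    have m12 : AEMeasurable (fun x => ‖G (k + 1) x‖ₑ * (‖om x‖ₑ * ‖fderiv ℝ v x‖ₑ) +
        ‖G (k + 2) x‖ₑ * (‖om x‖ₑ * ‖fderiv ℝ v x‖ₑ)) volume := m1.add m2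
    calc ∫⁻ x, ENNReal.ofReal (g x)
        = ∫⁻ x, ((‖G (k + 1) x‖ₑ * (‖om x‖ₑ * ‖fderiv ℝ v x‖ₑ) +
            ‖G (k + 2) x‖ₑ * (‖om x‖ₑ * ‖fderiv ℝ v x‖ₑ)) +
            (‖G (k + 1) x‖ₑ * ‖om x‖ₑ ^ (2 : ℝ) + ‖G (k + 2) x‖ₑ * ‖om x‖ₑ ^ (2 : ℝ))) :=
          lintegral_congr hsplit
      _ = ((∫⁻ x, ‖G (k + 1) x‖ₑ * (‖om x‖ₑ * ‖fderiv ℝ v x‖ₑ)) +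
            ∫⁻ x, ‖G (k + 2) x‖ₑ * (‖om x‖ₑ * ‖fderiv ℝ v x‖ₑ)) +
            ((∫⁻ x, ‖G (k + 1) x‖ₑ * ‖om x‖ₑ ^ (2 : ℝ)) + ∫⁻ x, ‖G (k + 2) x‖ₑ * ‖om x‖ₑ ^ (2 : ℝ)) := by
          rw [lintegral_add_left' m12, lintegral_add_left' m1, lintegral_add_left' m3]
      _ ≤ ((N₁ : ℝ≥0∞) * (Wm * Dm) + (N₂ : ℝ≥0∞) * (Wm * Dm)) +
            ((N₁ : ℝ≥0∞) * Wm2 + (N₂ : ℝ≥0∞) * Wm2) := by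
          have h1' := hT1 (k + 1)
          have h2' := hT1 (k + 2)
          have h3' := hT2 (k + 1)
          have h4' := hT2 (k + 2)
          rw [← hN₁E] at h1' h3'
          rw [← hN₂E] at h2' h4'
          exact add_le_add (add_le_add h1' h2') (add_le_add h3' h4')
      _ ≤ ((N₁ : ℝ≥0∞) * (Wm * (C₁ * Wm)) + (N₂ : ℝ≥0∞) * (Wm * (C₁ * Wm))) +
            ((N₁ : ℝ≥0∞) * Wm2 + (N₂ : ℝ≥0∞) * Wm2) :=
          add_le_add (add_le_add (mul_le_mul' le_rfl (mul_le_mul' le_rfl hDm_le))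
            (mul_le_mul' le_rfl (mul_le_mul' le_rfl hDm_le))) le_rfl
      _ = (Aw : ℝ≥0∞) * ((N₁ : ℝ≥0∞) + N₂) * Wm2 := by
          rw [hAw, ← hWmsq]; push_cast; ring
  -- interpolation `2`–`6` and Sobolev: `‖ω‖_m² ≤ a^θ (K² R)^{1-θ}`
  have hA : ENNReal.ofReal a = ∫⁻ x, ‖om x‖ₑ ^ (2 : ℝ) := by
    rw [ha, ofReal_integral_eq_lintegral_ofReal i_a (Eventually.of_forall fun x => sq_nonneg _)]
    refine lintegral_congr fun x => ?_
    rw [← ofReal_norm, ENNReal.ofReal_rpow_of_nonneg (norm_nonneg _) (by norm_num), Real.rpow_two]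
  have hS : eLpNorm om 6 volume ≤ K * eLpNorm (fderiv ℝ om) 2 volume :=
    eLpNorm_six_le_eLpNorm_fderiv_two volume finrank_euclideanSpace_fin hom1
      (eLpNorm_two_lt_top_of_lintegral_enorm_sq_lt_top l2ω)
  have hS6 : ∫⁻ x, ‖om x‖ₑ ^ (6 : ℝ) ≤ ((K : ℝ≥0∞) ^ 2 * ENNReal.ofReal R) ^ (3 : ℝ) := by
    have h6 : ∫⁻ x, ‖om x‖ₑ ^ (6 : ℝ) = eLpNorm om 6 volume ^ (6 : ℝ) := by
      rw [eLpNorm_eq_lintegral_rpow_enorm_toReal (by norm_num) (by norm_num), ENNReal.toReal_ofNat,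
        ← ENNReal.rpow_mul]
      norm_num
    rw [h6]
    calc eLpNorm om 6 volume ^ (6 : ℝ) ≤ (K * eLpNorm (fderiv ℝ om) 2 volume) ^ (6 : ℝ) := by gcongr
      _ = ((K : ℝ≥0∞) ^ 2 * eLpNorm (fderiv ℝ om) 2 volume ^ 2) ^ (3 : ℝ) := by
          rw [← mul_pow, ← ENNReal.rpow_natCast, ← ENNReal.rpow_mul]; norm_num
      _ ≤ ((K : ℝ≥0∞) ^ 2 * ENNReal.ofReal R) ^ (3 : ℝ) := by gcongr
  have hInterp : ∫⁻ x, ‖om x‖ₑ ^ m ≤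
      (∫⁻ x, ‖om x‖ₑ ^ (2 : ℝ)) ^ ((6 - m) / (6 - 2)) * (∫⁻ x, ‖om x‖ₑ ^ (6 : ℝ)) ^ ((m - 2) / (6 - 2)) :=
    lintegral_rpow_interpolate cω.aemeasurable.enorm zero_lt_two (by norm_num) h2m.le hm6.le
  have hθ' : (3 : ℝ) * (1 / (2 * ρ)) = 1 - θ := by rw [hθ]; ring
  have hWm2_le : Wm2 ≤ ENNReal.ofReal a ^ θ * ((K : ℝ≥0∞) ^ 2 * ENNReal.ofReal R) ^ (1 - θ) := by
    rw [hWm2]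
    calc (∫⁻ x, ‖om x‖ₑ ^ m) ^ (2 / m)
        ≤ ((∫⁻ x, ‖om x‖ₑ ^ (2 : ℝ)) ^ ((6 - m) / (6 - 2)) *
            (∫⁻ x, ‖om x‖ₑ ^ (6 : ℝ)) ^ ((m - 2) / (6 - 2))) ^ (2 / m) := by gcongr
      _ = (∫⁻ x, ‖om x‖ₑ ^ (2 : ℝ)) ^ θ * ((∫⁻ x, ‖om x‖ₑ ^ (6 : ℝ)) ^ (1 / (2 * ρ))) := by
          rw [ENNReal.mul_rpow_of_nonneg _ _ (by positivity), ← ENNReal.rpow_mul,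
            ← ENNReal.rpow_mul, hexpθ, hexp1]
      _ ≤ (∫⁻ x, ‖om x‖ₑ ^ (2 : ℝ)) ^ θ *
            ((((K : ℝ≥0∞) ^ 2 * ENNReal.ofReal R) ^ (3 : ℝ)) ^ (1 / (2 * ρ))) := by gcongr
      _ = ENNReal.ofReal a ^ θ * ((K : ℝ≥0∞) ^ 2 * ENNReal.ofReal R) ^ (1 - θ) := by
          rw [hA, ← ENNReal.rpow_mul, hθ']
  -- back to the reals
  have hfin : (Aw : ℝ≥0∞) * ((N₁ : ℝ≥0∞) + N₂) *
      (ENNReal.ofReal a ^ θ * ((K : ℝ≥0∞) ^ 2 * ENNReal.ofReal R) ^ (1 - θ)) ≠ ⊤ := by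
    refine ENNReal.mul_ne_top (ENNReal.mul_ne_top ENNReal.coe_ne_top (by simp)) (ENNReal.mul_ne_top ?_ ?_)
    · exact ENNReal.rpow_ne_top_of_nonneg hθ0.le ENNReal.ofReal_ne_top
    · exact ENNReal.rpow_ne_top_of_nonneg h1θ
        (ENNReal.mul_ne_top (ENNReal.pow_ne_top ENNReal.coe_ne_top) ENNReal.ofReal_ne_top)
  have hgR : ∫ x, g x ≤ ((Aw : ℝ) * ((N₁ : ℝ) + N₂)) * a ^ θ * ((K : ℝ) ^ 2 * R) ^ (1 - θ) := by
    have h1 : ENNReal.ofReal (∫ x, g x) ≤ (Aw : ℝ≥0∞) * ((N₁ : ℝ≥0∞) + N₂) *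
        (ENNReal.ofReal a ^ θ * ((K : ℝ≥0∞) ^ 2 * ENNReal.ofReal R) ^ (1 - θ)) :=
      hsum.trans (mul_le_mul' le_rfl hWm2_le)
    have h2 := (ENNReal.ofReal_le_iff_le_toReal hfin).1 h1
    refine h2.trans_eq ?_
    rw [ENNReal.toReal_mul, ENNReal.toReal_mul, ENNReal.toReal_mul, ← ENNReal.toReal_rpow,
      ← ENNReal.toReal_rpow, ENNReal.toReal_mul, ENNReal.toReal_pow, ENNReal.toReal_ofReal ha0,
      ENNReal.toReal_ofReal hR0, ENNReal.coe_toReal, ENNReal.toReal_add ENNReal.coe_ne_top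
      ENNReal.coe_ne_top, ENNReal.coe_toReal, ENNReal.coe_toReal, ENNReal.coe_toReal]
    ring
  -- Young's inequality
  set Nr : ℝ := (N₁ : ℝ) + N₂ with hNr
  have hNr0 : 0 ≤ Nr := by positivity
  have hAw0 : 0 ≤ (Aw : ℝ) := Aw.2
  have hyoung : ∫ x, g x ≤ ν / 2 * R +
      c₀ * ((Aw : ℝ) * Nr * (K : ℝ) ^ (2 * (1 - θ))) ^ (1 / θ) * a := by
    have hKR : ((K : ℝ) ^ 2 * R) ^ (1 - θ) = (K : ℝ) ^ (2 * (1 - θ)) * R ^ (1 - θ) := by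
      rw [Real.mul_rpow (sq_nonneg _) hR0, ← Real.rpow_two, ← Real.rpow_mul (NNReal.coe_nonneg K)]
    have h1 : ∫ x, g x ≤ ((Aw : ℝ) * Nr * (K : ℝ) ^ (2 * (1 - θ))) * a ^ θ * R ^ (1 - θ) := by
      calc ∫ x, g x ≤ ((Aw : ℝ) * Nr) * a ^ θ * ((K : ℝ) ^ 2 * R) ^ (1 - θ) := hgR
        _ = ((Aw : ℝ) * Nr * (K : ℝ) ^ (2 * (1 - θ))) * a ^ θ * R ^ (1 - θ) := by rw [hKR]; ring
    have h2 := mul_rpow_mul_rpow_le_absorb hθ0 hθ1 hν (a := (Aw : ℝ) * Nr * (K : ℝ) ^ (2 * (1 - θ)))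
      (x := R) (y := a) (by positivity) hR0 ha0
    rw [hc₀]
    linarith [h1, h2]
  -- the constant: `(Aw N K^{2(1-θ)})^{1/θ} = (Aw K^{2(1-θ)})^{1/θ} N^{1/θ}` and convexity
  have hq1 : 1 ≤ 1 / θ := by
    rw [le_div_iff₀ hθ0, one_mul]; exact hθ1.le
  have hsplitN : ((Aw : ℝ) * Nr * (K : ℝ) ^ (2 * (1 - θ))) ^ (1 / θ) =
      ((Aw : ℝ) * (K : ℝ) ^ (2 * (1 - θ))) ^ (1 / θ) * Nr ^ (1 / θ) := by
    rw [show (Aw : ℝ) * Nr * (K : ℝ) ^ (2 * (1 - θ)) = ((Aw : ℝ) * (K : ℝ) ^ (2 * (1 - θ))) * Nr by ring,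
      Real.mul_rpow (by positivity) hNr0]
  have hconv : Nr ^ (1 / θ) ≤ (2 : ℝ) ^ (1 / θ - 1) * ((N₁ : ℝ) ^ (1 / θ) + (N₂ : ℝ) ^ (1 / θ)) := by
    have h := NNReal.rpow_add_le_mul_rpow_add_rpow N₁ N₂ hq1
    have h' := NNReal.coe_le_coe.2 h
    push_cast at h'
    rw [hNr]
    exact h'
  -- conclusion
  have hmain : 2 * ∫ x, g x ≤ ν * R + C * (((N₁ : ℝ) ^ (1 / θ) + (N₂ : ℝ) ^ (1 / θ))) * a := by
    have h3 : c₀ * ((Aw : ℝ) * Nr * (K : ℝ) ^ (2 * (1 - θ))) ^ (1 / θ) * a ≤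
        c₀ * (((Aw : ℝ) * (K : ℝ) ^ (2 * (1 - θ))) ^ (1 / θ) *
          ((2 : ℝ) ^ (1 / θ - 1) * ((N₁ : ℝ) ^ (1 / θ) + (N₂ : ℝ) ^ (1 / θ)))) * a := by
      rw [hsplitN]
      gcongr
    rw [hCdef]
    nlinarith [hyoung, h3, ha0]
  calc 2 * ∫ x, ⟪om x, fderiv ℝ v x (om x)⟫ ≤ 2 * ∫ x, g x := by linarith [hSle]
    _ ≤ ν * R + C * (((N₁ : ℝ) ^ (1 / θ) + (N₂ : ℝ) ^ (1 / θ))) * a := hmain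
    _ = ν * R + C * ((eLpNorm (G (k + 1)) γ volume).toReal ^ (1 / θ) +
            (eLpNorm (G (k + 2)) γ volume).toReal ^ (1 / θ)) * a := by
        rw [hN₁R, hN₂R]


/-! ### The criterion -/

/-- Time measurability of the `L^γ` norms of the component gradients `∇u_j(t) = e_j^* ∘ ∇u(t)`
of a classical solution on `(0, T)`, `0 < γ < ∞` (joint continuity of `∇u` on `(0,T) × ℝ³` and
Tonelli). [folklore] -/
private theorem aemeasurable_eLpNorm_proj_fderiv_fg {ν T : ℝ}
    {u : ℝ → (EuclideanSpace ℝ (Fin 3)) → (EuclideanSpace ℝ (Fin 3))}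
    {p : ℝ → (EuclideanSpace ℝ (Fin 3)) → ℝ} (hsol : IsClassicalNSSolutionOn (Ico 0 T) ν 0 u p)
    {γ : ℝ≥0∞} (hγ0 : γ ≠ 0) (hγtop : γ ≠ ⊤) (j : Fin 3) :
    AEMeasurable (fun t => eLpNorm (fun x => (EuclideanSpace.proj j :
      EuclideanSpace ℝ (Fin 3) →L[ℝ] ℝ).comp (fderiv ℝ (u t) x)) γ volume)
      (volume.restrict (Ioo 0 T)) := by
  have hD : IsSmoothSpaceTimeOn (Ico 0 T) (fun t x => fderiv ℝ (u t) x) :=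
    hsol.smooth_velocity.fderiv_slice (uniqueDiffOn_Ico 0 T)
  have hcD : ContinuousOn (fun z : ℝ × EuclideanSpace ℝ (Fin 3) => fderiv ℝ (u z.1) z.2)
      (Ioo 0 T ×ˢ univ) :=
    hD.continuousOn.mono (prod_mono Ioo_subset_Ico_self Subset.rfl)
  have hmeasD : AEStronglyMeasurable (fun z : ℝ × EuclideanSpace ℝ (Fin 3) => fderiv ℝ (u z.1) z.2)
      ((volume.restrict (Ioo 0 T)).prod volume) := by
    rw [Measure.restrict_prod_eq_prod_univ]
    exact hcD.aestronglyMeasurable (measurableSet_Ioo.prod MeasurableSet.univ)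
  have hcj : Continuous fun L : EuclideanSpace ℝ (Fin 3) →L[ℝ] EuclideanSpace ℝ (Fin 3) =>
      (EuclideanSpace.proj j : EuclideanSpace ℝ (Fin 3) →L[ℝ] ℝ).comp L :=
    continuous_const.clm_comp continuous_id
  have hmj : AEStronglyMeasurable (fun z : ℝ × EuclideanSpace ℝ (Fin 3) =>
      (EuclideanSpace.proj j : EuclideanSpace ℝ (Fin 3) →L[ℝ] ℝ).comp (fderiv ℝ (u z.1) z.2))
      ((volume.restrict (Ioo 0 T)).prod volume) := hcj.comp_aestronglyMeasurable hmeasD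
  have hGI : AEMeasurable (fun t => ∫⁻ x, ‖(EuclideanSpace.proj j :
      EuclideanSpace ℝ (Fin 3) →L[ℝ] ℝ).comp (fderiv ℝ (u t) x)‖ₑ ^ γ.toReal)
      (volume.restrict (Ioo 0 T)) :=
    (hmj.enorm.pow_const _).lintegral_prod_right'
  have heq : (fun t => eLpNorm (fun x => (EuclideanSpace.proj j :
      EuclideanSpace ℝ (Fin 3) →L[ℝ] ℝ).comp (fderiv ℝ (u t) x)) γ volume) =
      fun t => (∫⁻ x, ‖(EuclideanSpace.proj j : EuclideanSpace ℝ (Fin 3) →L[ℝ] ℝ).comp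
        (fderiv ℝ (u t) x)‖ₑ ^ γ.toReal) ^ (1 / γ.toReal) :=
    funext fun t => eLpNorm_eq_lintegral_rpow_enorm_toReal hγ0 hγtop
  rw [heq]
  exact hGI.pow_const _

/-- In `Fin 3`, `k + 1 ≠ k`. [folklore] -/
private theorem fin3_add_one_ne_fg (k : Fin 3) : k + 1 ≠ k := by
  fin_cases k <;> decide

/-- In `Fin 3`, `k + 2 ≠ k`. [folklore] -/
private theorem fin3_add_two_ne_fg (k : Fin 3) : k + 2 ≠ k := by
  fin_cases k <;> decide

set_option maxHeartbeats 1600000 in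
/-- **A priori bound from two velocity-component gradients** (Fan–Gao 2009, proof of Thm. 1.1,
Lebesgue case: the weighted enstrophy inequality integrated with Grönwall). For a classical
unforced solution on `ℝ³ × [0, T)` in the Beale–Kato–Majda class on every `[0, T'']`, `T'' < T`,
with `∇u_j ∈ L^α(0,T; L^γ)` for the two indices `j ≠ k`, `2/α + 3/γ = 2`, `1 < α < ∞`: the
`H¹`-type quantity `∫|u(t)|² + ∫|∇u(t)|²_F` is bounded uniformly in `t ∈ [0, T)`. Ingredients:
Tao's energy bound, the slab Grönwall inequality
`integral_sq_norm_curl_le_mul_exp_of_weight_slab_ae` fed with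
`exists_two_mul_integral_stretching_le_of_two_velocity_gradients` at a.e. time, and
`∫|∇u|² ≤ ∫|ω|²`. [cite: FanGao2009EJDE, Thm. 1.1 with Remark 1.2 and proof (pp. 2–4); Tao2011, Lemma 8.1] -/
theorem exists_uniform_H1_bound_of_two_velocity_gradients {ν T : ℝ} (hν : 0 < ν) (hT : 0 < T)
    {u : ℝ → (EuclideanSpace ℝ (Fin 3)) → (EuclideanSpace ℝ (Fin 3))}
    {p : ℝ → (EuclideanSpace ℝ (Fin 3)) → ℝ}
    (hsol : IsClassicalNSSolutionOn (Ico 0 T) ν 0 u p)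
    (hreg : ∀ T'' < T, HasBoundedSobolevNormsOn (Icc 0 T'') u)
    {α γ : ℝ≥0∞} (h1α : 1 < α) (hαtop : α < ⊤) (hαγ : 2 / α + 3 / γ = 2) (k : Fin 3)
    (hG : ∀ j, j ≠ k → MemLqLp α γ
      (fun t x => (EuclideanSpace.proj j : EuclideanSpace ℝ (Fin 3) →L[ℝ] ℝ).comp (fderiv ℝ (u t) x))
      (Ioo 0 T)) :
    ∃ A : ℝ, 0 ≤ A ∧ ∀ t ∈ Ico 0 T,
      (∫⁻ x, ‖u t x‖ₑ ^ 2) + (∫⁻ x, ENNReal.ofReal (frobeniusNormSq (fderiv ℝ (u t) x))) ≤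
        ENNReal.ofReal A := by
  obtain ⟨Ce, hCetop, hTao⟩ := tao_finite_energy_smooth_energy_bound_holds
  -- exponents and the stretching constant
  obtain ⟨hγtop, hγ, hαq⟩ := bdv_exponents h1α hαtop hαγ
  set q : ℝ := 1 / (1 - 3 / (2 * γ.toReal)) with hq
  have hq0 : 0 ≤ q := by rw [← hαq]; exact ENNReal.toReal_nonneg
  obtain ⟨C, hC0, hstrC⟩ := exists_two_mul_integral_stretching_le_of_two_velocity_gradients hγ hγtop hν k
  -- the time weights of the two controlled components
  set N : Fin 3 → ℝ → ℝ := fun j t => (eLpNorm (fun x => (EuclideanSpace.proj j :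
    EuclideanSpace ℝ (Fin 3) →L[ℝ] ℝ).comp (fderiv ℝ (u t) x)) γ volume).toReal with hN
  have hN0 : ∀ j t, 0 ≤ N j t := fun j t => ENNReal.toReal_nonneg
  obtain ⟨hI1, hae1⟩ := lintegral_ofReal_rpow_gradient_lt_top h1α hαtop hαγ (hG (k + 1) (fin3_add_one_ne_fg k))
  obtain ⟨hI2, hae2⟩ := lintegral_ofReal_rpow_gradient_lt_top h1α hαtop hαγ (hG (k + 2) (fin3_add_two_ne_fg k))
  set I₁ : ℝ≥0∞ := ∫⁻ t in Ioo 0 T, ENNReal.ofReal (N (k + 1) t ^ q) with hI₁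
  set I₂ : ℝ≥0∞ := ∫⁻ t in Ioo 0 T, ENNReal.ofReal (N (k + 2) t ^ q) with hI₂
  have hI₁top : I₁ < ⊤ := hI1
  have hI₂top : I₂ < ⊤ := hI2
  set a : ℝ → ℝ := fun t => C * (N (k + 1) t ^ q + N (k + 2) t ^ q) with ha
  have ha0 : ∀ t, 0 ≤ a t := fun t => by positivity
  set Aw : ℝ := C * (I₁ + I₂).toReal with hAw
  have hAw0 : 0 ≤ Aw := by positivity
  have haE : ∀ t, ENNReal.ofReal (a t) =
      ENNReal.ofReal C * (ENNReal.ofReal (N (k + 1) t ^ q) + ENNReal.ofReal (N (k + 2) t ^ q)) := by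
    intro t
    rw [ha]; dsimp only
    rw [ENNReal.ofReal_mul hC0, ENNReal.ofReal_add (by positivity) (by positivity)]
  -- measurability in time of the weights
  have hγ0 : γ ≠ 0 := (lt_trans (by norm_num) hγ).ne'
  have hNmeas : ∀ j, AEMeasurable (fun t => ENNReal.ofReal (N j t ^ q)) (volume.restrict (Ioo 0 T)) := by
    intro j
    have hE := aemeasurable_eLpNorm_proj_fderiv_fg hsol hγ0 hγtop j
    have hNj : AEMeasurable (N j) (volume.restrict (Ioo 0 T)) :=
      ENNReal.measurable_toReal.comp_aemeasurable hE
    exact ENNReal.measurable_ofReal.comp_aemeasurable (hNj.pow_const q)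
  have hAint : ∀ T'' ≤ T, ∫⁻ t in Ioo 0 T'', ENNReal.ofReal (a t) ≤ ENNReal.ofReal Aw := by
    intro T'' hT''
    have hCtop : ENNReal.ofReal C ≠ ⊤ := ENNReal.ofReal_ne_top
    calc ∫⁻ t in Ioo 0 T'', ENNReal.ofReal (a t)
        ≤ ∫⁻ t in Ioo 0 T, ENNReal.ofReal (a t) := lintegral_mono_set (Ioo_subset_Ioo le_rfl hT'')
      _ = ∫⁻ t in Ioo 0 T, ENNReal.ofReal C *
            (ENNReal.ofReal (N (k + 1) t ^ q) + ENNReal.ofReal (N (k + 2) t ^ q)) :=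
          lintegral_congr fun t => haE t
      _ = ENNReal.ofReal C * (I₁ + I₂) := by
          rw [lintegral_const_mul' _ _ hCtop, lintegral_add_left' (hNmeas (k + 1))]
      _ = ENNReal.ofReal Aw := by
          rw [hAw, ENNReal.ofReal_mul hC0, ENNReal.ofReal_toReal]
          exact (ENNReal.add_lt_top.2 ⟨hI₁top, hI₂top⟩).ne
  -- a.e. finiteness of the two vorticity components in `L^γ`
  have hae1' : ∀ᵐ s ∂volume, s ∈ Ioo 0 T → eLpNorm (fun x => (EuclideanSpace.proj (k + 1) :
      EuclideanSpace ℝ (Fin 3) →L[ℝ] ℝ).comp (fderiv ℝ (u s) x)) γ volume < ⊤ := hae1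
  have hae2' : ∀ᵐ s ∂volume, s ∈ Ioo 0 T → eLpNorm (fun x => (EuclideanSpace.proj (k + 2) :
      EuclideanSpace ℝ (Fin 3) →L[ℝ] ℝ).comp (fderiv ℝ (u s) x)) γ volume < ⊤ := hae2
  -- the initial energy and enstrophy
  have hreg0 : HasBoundedSobolevNormsOn (Icc 0 (T / 2)) u := hreg (T / 2) (by linarith)
  have h00 : (0 : ℝ) ∈ Icc 0 (T / 2) := ⟨le_rfl, by linarith⟩
  set E₀ : ℝ≥0∞ := ∫⁻ x, ‖u 0 x‖ₑ ^ 2 with hE₀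
  have hE₀top : E₀ < ⊤ := by
    obtain ⟨C0, hC0'⟩ := hreg0 0
    refine lt_of_le_of_lt (le_of_eq (lintegral_congr fun x => ?_)) ((hC0' 0 h00).trans_lt ENNReal.coe_lt_top)
    rw [← ofReal_norm, ← ofReal_norm, norm_iteratedFDeriv_zero]
  have hCE : Ce * E₀ < ⊤ := ENNReal.mul_lt_top hCetop hE₀top
  set Ē : ℝ := (Ce * E₀).toReal with hĒ
  have hĒ0 : 0 ≤ Ē := ENNReal.toReal_nonneg
  set Y₀ : ℝ := ∫ x, ‖curl (u 0) x‖ ^ 2 with hY₀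
  have hY₀0 : 0 ≤ Y₀ := integral_nonneg fun x => sq_nonneg _
  set Ystar : ℝ := Y₀ * Real.exp Aw with hYstar
  have hYstar0 : 0 ≤ Ystar := by positivity
  refine ⟨Ē + Ystar, by positivity, ?_⟩
  intro t ht
  -- a closed slab containing `t`
  set T'' : ℝ := (t + T) / 2 with hT''def
  have htT'' : t < T'' := by rw [hT''def]; linarith [ht.2]
  have hT''T : T'' < T := by rw [hT''def]; linarith [ht.2]
  have hT''pos : 0 < T'' := lt_of_le_of_lt ht.1 htT''
  have hS : IsClassicalNSSolutionOn (Icc 0 T'') ν 0 u p :=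
    hsol.mono (Icc_subset_Ico_right hT''T) (uniqueDiffOn_Icc hT''pos)
  have hB : HasBoundedSobolevNormsOn (Icc 0 T'') u := hreg T'' hT''T
  have htS : t ∈ Icc 0 T'' := ⟨ht.1, htT''.le⟩
  have hsm : ∀ s ∈ Icc 0 T'', ContDiff ℝ ∞ (u s) := fun s hs => hS.contDiff_velocity hs
  have hsm3 : ∀ s ∈ Icc 0 T'', ContDiff ℝ 3 (u s) := fun s hs => (hsm s hs).of_le (by norm_cast)
  have hsm2 : ∀ s ∈ Icc 0 T'', ContDiff ℝ 2 (u s) := fun s hs => (hsm s hs).of_le (by norm_cast)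
  have hfin : ∀ n, ∀ s ∈ Icc 0 T'', ∫⁻ x, ‖iteratedFDeriv ℝ n (u s) x‖ₑ ^ 2 < ⊤ := fun n s hs => by
    obtain ⟨Cn, hCn⟩ := hB n
    exact (hCn s hs).trans_lt ENNReal.coe_lt_top
  obtain ⟨B₀, hB₀⟩ := linfty_bound_of_hasBoundedSobolevNormsOn_holds hsm2 hB
  obtain ⟨B₁, hB₁0, hB₁⟩ := exists_forall_norm_fderiv_le_of_hasBoundedSobolevNormsOn hsm3 hB
  -- Tao's energy class on the slab
  have hfe : ∃ A : ℝ≥0∞, A < ⊤ ∧ ∀ s ∈ Icc 0 T'', ∫⁻ x, ‖u s x‖ₑ ^ 2 ≤ A := by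
    obtain ⟨C0, hC0'⟩ := hB 0
    refine ⟨C0, ENNReal.coe_lt_top, fun s hs => ?_⟩
    refine le_trans (le_of_eq (lintegral_congr fun x => ?_)) (hC0' s hs)
    rw [← ofReal_norm, ← ofReal_norm, norm_iteratedFDeriv_zero]
  obtain ⟨hen, -⟩ := hTao ν T'' hν hT''pos u p hS hfe
  have hen' : ∀ s ∈ Icc 0 T'', ∫⁻ x, ‖u s x‖ₑ ^ 2 ≤ ENNReal.ofReal Ē := fun s hs => by
    rw [hĒ, ENNReal.ofReal_toReal hCE.ne]
    exact hen s hs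
  -- the slices on the slab: `L²`, `L^∞` tails
  have hL2 : ∀ s ∈ Icc 0 T'', eLpNorm (u s) 2 volume < ⊤ := fun s hs => by
    refine eLpNorm_two_lt_top_of_lintegral_enorm_sq_lt_top ?_
    exact (hen' s hs).trans_lt ENNReal.ofReal_lt_top
  have hLinf : ∀ s ∈ Icc 0 T'', eLpNorm (u s) ⊤ volume < ⊤ := fun s hs => by
    rw [eLpNorm_exponent_top]
    refine lt_of_le_of_lt (eLpNormEssSup_le_of_ae_enorm_bound (C := ENNReal.ofReal B₀)
      (Eventually.of_forall fun x => ?_)) ENNReal.ofReal_lt_top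
    rw [← ofReal_norm]
    exact ENNReal.ofReal_le_ofReal (hB₀ s hs x)
  -- the stretching estimate at a.e. time of the slab
  have hstrS : ∀ᵐ s ∂(volume.restrict (Ioo 0 T'')),
      2 * ∫ x, ⟪curl (u s) x, fderiv ℝ (u s) x (curl (u s) x)⟫ ≤
        ν * (∫ x, frobeniusNormSq (fderiv ℝ (curl (u s)) x)) + a s * (∫ x, ‖curl (u s) x‖ ^ 2) := by
    rw [ae_restrict_iff' measurableSet_Ioo]
    filter_upwards [hae1', hae2'] with s h1 h2 hsI
    have hsT : s ∈ Ioo 0 T := ⟨hsI.1, hsI.2.trans hT''T⟩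
    have hsS : s ∈ Icc 0 T'' := ⟨hsI.1.le, hsI.2.le⟩
    exact hstrC (u s) (hsm s hsS) (hS.divFree s hsS) (hL2 s hsS) (hLinf s hsS) (hB₁ s hsS)
      (hfin 1 s hsS) (hfin 2 s hsS) (h1 hsT) (h2 hsT)
  -- the enstrophy bound on the slab
  have hY := integral_sq_norm_curl_le_mul_exp_of_weight_slab_ae hν hT''pos hS hB ha0 hAw0
    (hAint T'' hT''T.le) hstrS t htS
  have hYstar_le : ∫ x, ‖curl (u t) x‖ ^ 2 ≤ Ystar := hY
  -- the `H¹` quantity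
  have hvt : ContDiff ℝ ∞ (u t) := hS.contDiff_velocity htS
  have hcurl_int : Integrable fun x => ‖curl (u t) x‖ ^ 2 := by
    refine integrable_sq_norm_of_lintegral_lt_top (continuous_curl (hvt.of_le (by norm_cast))) ?_
    exact lt_of_le_of_lt (lintegral_curl_sq_le (u t)) (ENNReal.mul_lt_top ENNReal.ofReal_lt_top (hfin 1 t htS))
  have hdc : ∫⁻ x, ENNReal.ofReal (frobeniusNormSq (fderiv ℝ (u t) x)) ≤ ENNReal.ofReal Ystar := by
    refine (lintegral_frobeniusNormSq_fderiv_le_lintegral_sq_norm_curl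
      (hvt.of_le (by norm_cast)) (hS.divFree t htS)
      ((hen' t htS).trans_lt ENNReal.ofReal_lt_top)).trans ?_
    rw [show (∫⁻ x, ‖curl (u t) x‖ₑ ^ 2) = ∫⁻ x, ENNReal.ofReal (‖curl (u t) x‖ ^ 2) from
      lintegral_congr fun x => by rw [← ofReal_norm, ENNReal.ofReal_pow (norm_nonneg _)],
      ← ofReal_integral_eq_lintegral_ofReal hcurl_int (Eventually.of_forall fun x => sq_nonneg _)]
    exact ENNReal.ofReal_le_ofReal hYstar_le
  calc (∫⁻ x, ‖u t x‖ₑ ^ 2) + (∫⁻ x, ENNReal.ofReal (frobeniusNormSq (fderiv ℝ (u t) x)))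
      ≤ ENNReal.ofReal Ē + ENNReal.ofReal Ystar := add_le_add (hen' t htS) hdc
    _ = ENNReal.ofReal (Ē + Ystar) := (ENNReal.ofReal_add hĒ0 hYstar0).symm

/-- **Two velocity-component gradients in the critical class: continuation** (Fan–Gao 2009,
Thm. 1.1 with Remark 1.2, the Lebesgue-space case `∇ũ ∈ L^α(0,T; L^γ)`, `2/α + 3/γ = 2` — the
scale-invariant improvement of Chae–Choe's Thm. 2). For a classical unforced solution on
`ℝ³ × [0, T)` in the Beale–Kato–Majda class: if for an index `k` the gradients
`∇u_j = e_j^* ∘ ∇u`, `j ≠ k`, of the two other velocity components lie in `L^α(0,T; L^γ(ℝ³))`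
with `2/α + 3/γ = 2`, `1 < α < ∞`, then the solution continues in the class past `T`
(`exists_uniform_H1_bound_of_two_velocity_gradients` and the tree's `H¹` continuation
`hasSobolevExtensionPast_of_uniform_H1_bound`). [cite: FanGao2009EJDE, Thm. 1.1 with Remark 1.2 (p. 2)] -/
theorem fanGao_two_velocity_gradients_criterion {ν : ℝ} (hν : 0 < ν) {T : ℝ} (hT : 0 < T)
    {u : ℝ → (EuclideanSpace ℝ (Fin 3)) → (EuclideanSpace ℝ (Fin 3))}
    {p : ℝ → (EuclideanSpace ℝ (Fin 3)) → ℝ}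
    (hsol : IsClassicalNSSolutionOn (Ico 0 T) ν 0 u p)
    (hreg : ∀ T'' < T, HasBoundedSobolevNormsOn (Icc 0 T'') u)
    {α γ : ℝ≥0∞} (h1α : 1 < α) (hαtop : α < ⊤) (hαγ : 2 / α + 3 / γ = 2) (k : Fin 3)
    (hG : ∀ j, j ≠ k → MemLqLp α γ
      (fun t x => (EuclideanSpace.proj j : EuclideanSpace ℝ (Fin 3) →L[ℝ] ℝ).comp (fderiv ℝ (u t) x))
      (Ioo 0 T)) :
    HasSobolevExtensionPast ν u T := by
  obtain ⟨A, hA0, hA⟩ :=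
    exists_uniform_H1_bound_of_two_velocity_gradients hν hT hsol hreg h1α hαtop hαγ k hG
  exact hasSobolevExtensionPast_of_uniform_H1_bound hν hT hsol hreg hA0 hA

/-- **The hypothesis `2/α + 3/γ ≤ 2`** (as in Remark 1.2 of Fan–Gao: the multiplier-space
classes contain the Lebesgue ones), for `3/2 < γ < ∞` and any `α ≤ ∞`: on the bounded
interval `(0, T)` the hypothesis reduces to the critical one by Hölder's inequality in time
(`MemLqLp.of_exponent_le`). [cite: FanGao2009EJDE, Thm. 1.1 with Remark 1.2 (p. 2)] -/
theorem fanGao_two_velocity_gradients_criterion_of_le {ν : ℝ} (hν : 0 < ν) {T : ℝ}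
    (hT : 0 < T)
    {u : ℝ → (EuclideanSpace ℝ (Fin 3)) → (EuclideanSpace ℝ (Fin 3))}
    {p : ℝ → (EuclideanSpace ℝ (Fin 3)) → ℝ}
    (hsol : IsClassicalNSSolutionOn (Ico 0 T) ν 0 u p)
    (hreg : ∀ T'' < T, HasBoundedSobolevNormsOn (Icc 0 T'') u)
    {α γ : ℝ≥0∞} (h1α : 1 < α) (hγ : 3 / 2 < γ) (hγtop : γ < ⊤) (hαγ : 2 / α + 3 / γ ≤ 2)
    (k : Fin 3) (hG : ∀ j, j ≠ k → MemLqLp α γ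
      (fun t x => (EuclideanSpace.proj j : EuclideanSpace ℝ (Fin 3) →L[ℝ] ℝ).comp (fderiv ℝ (u t) x))
      (Ioo 0 T)) :
    HasSobolevExtensionPast ν u T := by
  -- the real exponent data
  have hγ0 : γ ≠ 0 := (lt_trans (by norm_num) hγ).ne'
  have hγtop' : γ ≠ ⊤ := hγtop.ne
  set ρ : ℝ := γ.toReal with hρ
  have hρ32 : 3 / 2 < ρ := by
    have h := ENNReal.toReal_strict_mono hγtop' hγ
    rwa [ENNReal.toReal_div, ENNReal.toReal_ofNat, ENNReal.toReal_ofNat] at h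
  have hρ0 : 0 < ρ := by linarith
  have hγρ : γ = ENNReal.ofReal ρ := (ENNReal.ofReal_toReal hγtop').symm
  set s : ℝ := 1 - 3 / (2 * ρ) with hs
  have h32 : 3 / (2 * ρ) = 3 / ρ / 2 := by
    rw [mul_comm, ← div_div]
  have hs0 : 0 < s := by
    rw [hs, sub_pos, div_lt_one (by positivity)]; linarith
  have hs1 : s < 1 := by
    rw [hs]; linarith [div_pos (zero_lt_three' ℝ) (by positivity : (0 : ℝ) < 2 * ρ)]
  -- the critical time exponent `α'`, `2/α' + 3/γ = 2`
  set α' : ℝ≥0∞ := ENNReal.ofReal (1 / s) with hα'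
  have h1s : 1 < 1 / s := by rw [lt_div_iff₀ hs0]; linarith
  have h1α' : 1 < α' := by
    rw [hα', ← ENNReal.ofReal_one]; exact (ENNReal.ofReal_lt_ofReal_iff (by positivity)).2 h1s
  have hα'top : α' < ⊤ := ENNReal.ofReal_lt_top
  have hα'γ : 2 / α' + 3 / γ = 2 := by
    rw [hα', hγρ, show (2 : ℝ≥0∞) = ENNReal.ofReal 2 by norm_num,
      show (3 : ℝ≥0∞) = ENNReal.ofReal 3 by norm_num,
      ← ENNReal.ofReal_div_of_pos (by positivity : (0 : ℝ) < 1 / s),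
      ← ENNReal.ofReal_div_of_pos hρ0, ← ENNReal.ofReal_add (by positivity) (by positivity)]
    congr 1
    rw [hs]; field_simp; ring
  -- `α' ≤ α`
  have hα'α : α' ≤ α := by
    by_cases hαtop : α = ⊤
    · rw [hαtop]; exact le_top
    · have hα0 : α ≠ 0 := (lt_trans zero_lt_one h1α).ne'
      have ha0 : 0 < α.toReal := ENNReal.toReal_pos hα0 hαtop
      have h2 : 2 / α.toReal + 3 / ρ ≤ 2 := by
        have hfin1 : 2 / α ≠ ⊤ := ENNReal.div_ne_top (by norm_num) hα0
        have hfin2 : 3 / γ ≠ ⊤ := ENNReal.div_ne_top (by norm_num) hγ0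
        have h := (ENNReal.toReal_le_toReal (ENNReal.add_ne_top.2 ⟨hfin1, hfin2⟩) (by norm_num)).2 hαγ
        rw [ENNReal.toReal_add hfin1 hfin2, ENNReal.toReal_div, ENNReal.toReal_div,
          ENNReal.toReal_ofNat, ENNReal.toReal_ofNat] at h
        exact h
      have h2' : 2 / α.toReal ≤ 2 - 3 / ρ := by linarith
      have h2'' : 2 ≤ (2 - 3 / ρ) * α.toReal := (div_le_iff₀ ha0).1 h2'
      have h3 : 1 / s ≤ α.toReal := by
        rw [div_le_iff₀ hs0, hs, h32]
        linarith
      calc α' = ENNReal.ofReal (1 / s) := rfl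
        _ ≤ ENNReal.ofReal α.toReal := ENNReal.ofReal_le_ofReal h3
        _ = α := ENNReal.ofReal_toReal hαtop
  -- Hölder in time
  have hG' : ∀ j, j ≠ k → MemLqLp α' γ (fun t x => (EuclideanSpace.proj j :
      EuclideanSpace ℝ (Fin 3) →L[ℝ] ℝ).comp (fderiv ℝ (u t) x)) (Ioo 0 T) := by
    intro j hj
    refine (hG j hj).of_exponent_le hα'α measure_Ioo_lt_top.ne ?_
    exact (ENNReal.measurable_toReal.comp_aemeasurable
      (aemeasurable_eLpNorm_proj_fderiv_fg hsol hγ0 hγtop' j)).aestronglyMeasurable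
  exact fanGao_two_velocity_gradients_criterion hν hT hsol hreg h1α' hα'top hα'γ k hG'


/-! ### The endpoint `α = 1`, `γ = ∞` ((1.5) with `r = 0`: `Ẋ₀ = L^∞`) -/

/-- A continuous function on `ℝ³` is bounded pointwise by its `L^∞` norm (Lebesgue measure charges
open sets). [folklore] -/
private theorem enorm_le_eLpNorm_top_of_continuous_fg {F : Type*} [NormedAddCommGroup F]
    {f : EuclideanSpace ℝ (Fin 3) → F} (hf : Continuous f) (x : EuclideanSpace ℝ (Fin 3)) :
    ‖f x‖ₑ ≤ eLpNorm f ⊤ volume := by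
  rw [eLpNorm_exponent_top]
  by_contra h
  rw [not_le] at h
  have hU : IsOpen {y | eLpNormEssSup f volume < ‖f y‖ₑ} := isOpen_lt continuous_const hf.enorm
  have hnull : volume {y | eLpNormEssSup f volume < ‖f y‖ₑ} = 0 := by
    have hae : ∀ᵐ y ∂(volume : Measure (EuclideanSpace ℝ (Fin 3))), ‖f y‖ₑ ≤ eLpNormEssSup f volume :=
      ae_le_eLpNormEssSup
    rw [ae_iff] at hae
    simpa only [not_le] using hae
  have hem := (hU.measure_eq_zero_iff (μ := volume)).1 hnull
  have hx : x ∈ {y | eLpNormEssSup f volume < ‖f y‖ₑ} := h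
  rw [hem] at hx
  exact hx

/-- For a continuous function on `ℝ³` and a dense set `D`, the `L^∞` norm is the supremum over
`D`. [folklore] -/
private theorem eLpNorm_top_eq_iSup_of_continuous_fg {F : Type*} [NormedAddCommGroup F]
    {f : EuclideanSpace ℝ (Fin 3) → F} (hf : Continuous f) {D : Set (EuclideanSpace ℝ (Fin 3))}
    (hD : Dense D) : eLpNorm f ⊤ volume = ⨆ q : D, ‖f q‖ₑ := by
  refine le_antisymm ?_ (iSup_le fun q => enorm_le_eLpNorm_top_of_continuous_fg hf q)
  rw [eLpNorm_exponent_top]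
  refine essSup_le_of_ae_le _ (Eventually.of_forall fun y => ?_)
  have hC : IsClosed {z | ‖f z‖ₑ ≤ ⨆ q : D, ‖f q‖ₑ} := isClosed_le hf.enorm continuous_const
  have hDC : D ⊆ {z | ‖f z‖ₑ ≤ ⨆ q : D, ‖f q‖ₑ} := fun z hz => le_iSup (fun q : D => ‖f q‖ₑ) ⟨z, hz⟩
  have hy : y ∈ closure D := by rw [hD.closure_eq]; exact mem_univ _
  exact closure_minimal hDC hC hy

/-- Time measurability of the `L^∞` norms of the component gradients of a classical solution
on `(0, T)` (supremum over a countable dense set of continuous functions of `t`). [folklore] -/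
private theorem aemeasurable_eLpNorm_top_proj_fderiv_fg {ν T : ℝ}
    {u : ℝ → (EuclideanSpace ℝ (Fin 3)) → (EuclideanSpace ℝ (Fin 3))}
    {p : ℝ → (EuclideanSpace ℝ (Fin 3)) → ℝ} (hsol : IsClassicalNSSolutionOn (Ico 0 T) ν 0 u p)
    (j : Fin 3) :
    AEMeasurable (fun t => eLpNorm (fun x => (EuclideanSpace.proj j :
      EuclideanSpace ℝ (Fin 3) →L[ℝ] ℝ).comp (fderiv ℝ (u t) x)) ⊤ volume)
      (volume.restrict (Ioo 0 T)) := by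
  obtain ⟨D, hDc, hDd⟩ := TopologicalSpace.exists_countable_dense (EuclideanSpace ℝ (Fin 3))
  haveI : Countable D := hDc.to_subtype
  have hD' : IsSmoothSpaceTimeOn (Ico 0 T) (fun t x => fderiv ℝ (u t) x) :=
    hsol.smooth_velocity.fderiv_slice (uniqueDiffOn_Ico 0 T)
  have hcD : ContinuousOn (fun z : ℝ × EuclideanSpace ℝ (Fin 3) => fderiv ℝ (u z.1) z.2)
      (Ioo 0 T ×ˢ univ) :=
    hD'.continuousOn.mono (prod_mono Ioo_subset_Ico_self Subset.rfl)
  -- each `t ↦ ‖∇u_j(t)(q)‖ₑ` is continuous on `(0,T)`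
  have hq : ∀ q : D, AEMeasurable (fun t => ‖(EuclideanSpace.proj j :
      EuclideanSpace ℝ (Fin 3) →L[ℝ] ℝ).comp (fderiv ℝ (u t) (q : EuclideanSpace ℝ (Fin 3)))‖ₑ)
      (volume.restrict (Ioo 0 T)) := by
    intro q
    have h1 : ContinuousOn (fun t => fderiv ℝ (u t) (q : EuclideanSpace ℝ (Fin 3))) (Ioo 0 T) := by
      have hm : MapsTo (fun t : ℝ => (t, (q : EuclideanSpace ℝ (Fin 3)))) (Ioo 0 T) (Ioo 0 T ×ˢ univ) :=
        fun t ht => ⟨ht, mem_univ _⟩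
      exact hcD.comp (continuousOn_id.prodMk continuousOn_const) hm
    have h2 : ContinuousOn (fun t => ‖(EuclideanSpace.proj j :
        EuclideanSpace ℝ (Fin 3) →L[ℝ] ℝ).comp (fderiv ℝ (u t) (q : EuclideanSpace ℝ (Fin 3)))‖ₑ)
        (Ioo 0 T) :=
      ((continuous_const.clm_comp continuous_id).continuousOn.comp h1 (mapsTo_univ _ _)).enorm
    exact h2.aemeasurable measurableSet_Ioo
  have hsup : AEMeasurable (fun t => ⨆ q : D, ‖(EuclideanSpace.proj j :
      EuclideanSpace ℝ (Fin 3) →L[ℝ] ℝ).comp (fderiv ℝ (u t) (q : EuclideanSpace ℝ (Fin 3)))‖ₑ)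
      (volume.restrict (Ioo 0 T)) := AEMeasurable.iSup hq
  refine hsup.congr ?_
  rw [EventuallyEq, ae_restrict_iff' measurableSet_Ioo]
  refine Eventually.of_forall fun t ht => ?_
  have hc : Continuous fun x => (EuclideanSpace.proj j : EuclideanSpace ℝ (Fin 3) →L[ℝ] ℝ).comp
      (fderiv ℝ (u t) x) :=
    continuous_const.clm_comp (((hsol.contDiff_velocity (Ioo_subset_Ico_self ht))).continuous_fderiv
      (by simp))
  exact (eLpNorm_top_eq_iSup_of_continuous_fg hc hDd).symm

/-- `∫₀ᵀ ‖G(t)‖_{L^r} dt < ∞` for `G ∈ L¹(0,T; L^r)`. [folklore] -/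
private theorem lintegral_ofReal_toReal_lt_top_fg {X F : Type*} [MeasureSpace X] [NormedAddCommGroup F]
    {r : ℝ≥0∞} {G : ℝ → X → F} {T : ℝ} (hS : MemLqLp 1 r G (Ioo 0 T)) :
    ∫⁻ t in Ioo 0 T, ENNReal.ofReal (eLpNorm (G t) r volume).toReal < ⊤ := by
  set N : ℝ → ℝ := fun t => (eLpNorm (G t) r volume).toReal with hN
  have hN0 : ∀ t, 0 ≤ N t := fun t => ENNReal.toReal_nonneg
  have hlt : ∫⁻ t, ‖N t‖ₑ ^ (1 : ℝ≥0∞).toReal ∂(volume.restrict (Ioo 0 T)) < ⊤ :=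
    lintegral_rpow_enorm_lt_top_of_eLpNorm_lt_top one_ne_zero ENNReal.one_ne_top hS.2
  rw [ENNReal.toReal_one] at hlt
  refine lt_of_le_of_lt (le_of_eq (lintegral_congr fun t => ?_)) hlt
  rw [ENNReal.rpow_one, Real.enorm_eq_ofReal (hN0 t)]

/-- **The stretching estimate at the endpoint `γ = ∞`** (Fan–Gao 2009, (1.5) with `r = 0`,
`Ẋ₀ = L^∞`: `I ≤ 2‖∇ũ‖_∞ ‖∇u‖²₂`). For a `C^∞` divergence-free field `v` on `ℝ³` with `v ∈ L²`,
`∇v` bounded and square integrable, and `ω = curl v`,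
`2∫⟪ω, (∇v)ω⟫ ≤ 4(‖∇v_{k+1}‖_∞ + ‖∇v_{k+2}‖_∞) ∫|ω|²`: the pointwise structure
`abs_inner_curlCLM_apply_le_two_rows`, `|∇v_j(x)| ≤ ‖∇v_j‖_∞`, `2‖∇v‖|ω| ≤ ‖∇v‖² + |ω|²` and
`∫‖∇v‖² ≤ ∫|∇v|²_F ≤ ∫|ω|²` (`div v = 0`). [cite: FanGao2009EJDE, Thm. 1.1 (1.5) with `r = 0` and proof (3.1) (pp. 2–4)] -/
theorem two_mul_integral_stretching_le_of_two_velocity_gradients_top (k : Fin 3)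
    (v : EuclideanSpace ℝ (Fin 3) → EuclideanSpace ℝ (Fin 3)) (hv : ContDiff ℝ ∞ v)
    (hdiv : VectorCalculus.IsDivFree v) (hL2 : ∫⁻ x, ‖v x‖ₑ ^ 2 < ⊤)
    {B₁ : ℝ} (hB₁ : ∀ x, ‖fderiv ℝ v x‖ ≤ B₁) (hv1 : ∫⁻ x, ‖iteratedFDeriv ℝ 1 v x‖ₑ ^ 2 < ⊤) :
    2 * ∫ x, ⟪curl v x, fderiv ℝ v x (curl v x)⟫ ≤
      4 * ((eLpNorm (fun x => (EuclideanSpace.proj (k + 1) : EuclideanSpace ℝ (Fin 3) →L[ℝ] ℝ).comp (fderiv ℝ v x)) ⊤ volume).toReal + (eLpNorm (fun x => (EuclideanSpace.proj (k + 2) : EuclideanSpace ℝ (Fin 3) →L[ℝ] ℝ).comp (fderiv ℝ v x)) ⊤ volume).toReal) *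
        ∫ x, ‖curl v x‖ ^ 2 := by
  set om : EuclideanSpace ℝ (Fin 3) → EuclideanSpace ℝ (Fin 3) := curl v with homdef
  have hom : ContDiff ℝ ∞ om := contDiff_curl (n := ⊤) (hv.of_le (by exact_mod_cast le_top))
  have cω : Continuous om := hom.continuous
  have cDv : Continuous (fderiv ℝ v) := hv.continuous_fderiv (by simp)
  set G : Fin 3 → EuclideanSpace ℝ (Fin 3) → (EuclideanSpace ℝ (Fin 3) →L[ℝ] ℝ) := fun j x =>
    (EuclideanSpace.proj j : EuclideanSpace ℝ (Fin 3) →L[ℝ] ℝ).comp (fderiv ℝ v x) with hGdef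
  have cG : ∀ j, Continuous (G j) := fun j => continuous_const.clm_comp cDv
  have hGle : ∀ j x, ‖G j x‖ ≤ ‖fderiv ℝ v x‖ := by
    intro j x
    refine ContinuousLinearMap.opNorm_le_bound _ (norm_nonneg _) fun y => ?_
    rw [hGdef]
    dsimp only
    rw [ContinuousLinearMap.comp_apply, Real.norm_eq_abs]
    exact (abs_apply_le_norm_fg _ j).trans ((fderiv ℝ v x).le_opNorm y)
  have hGtop : ∀ j, eLpNorm (G j) ⊤ volume < ⊤ := fun j => by
    rw [eLpNorm_exponent_top]
    refine lt_of_le_of_lt (eLpNormEssSup_le_of_ae_enorm_bound (C := ENNReal.ofReal B₁)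
      (Eventually.of_forall fun x => ?_)) ENNReal.ofReal_lt_top
    rw [← ofReal_norm]
    exact ENNReal.ofReal_le_ofReal ((hGle j x).trans (hB₁ x))
  set N : Fin 3 → ℝ := fun j => (eLpNorm (G j) ⊤ volume).toReal with hN
  have hN0 : ∀ j, 0 ≤ N j := fun j => ENNReal.toReal_nonneg
  have hGN : ∀ j x, ‖G j x‖ ≤ N j := by
    intro j x
    have h := enorm_le_eLpNorm_top_of_continuous_fg (cG j) x
    rw [← ofReal_norm] at h
    exact (ENNReal.ofReal_le_iff_le_toReal (hGtop j).ne).1 h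
  set Ns : ℝ := N (k + 1) + N (k + 2) with hNs
  have hNs0 : 0 ≤ Ns := add_nonneg (hN0 _) (hN0 _)
  -- `ω, ∇v ∈ L²`
  have l2ω : ∫⁻ x, ‖om x‖ₑ ^ 2 < ⊤ :=
    lt_of_le_of_lt (lintegral_curl_sq_le v) (ENNReal.mul_lt_top ENNReal.ofReal_lt_top hv1)
  have l2Dv : ∫⁻ x, ‖fderiv ℝ v x‖ₑ ^ 2 < ⊤ := by
    refine lt_of_le_of_lt (le_of_eq (lintegral_congr fun x => ?_)) hv1
    rw [← ofReal_norm, ← ofReal_norm, norm_iteratedFDeriv_one v]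
  have i_Z : Integrable (fun x => ‖om x‖ ^ 2) volume := integrable_sq_norm_of_lintegral_lt_top cω l2ω
  have i_D : Integrable (fun x => ‖fderiv ℝ v x‖ ^ 2) volume := integrable_sq_norm_of_lintegral_lt_top cDv l2Dv
  -- `∫‖∇v‖² ≤ ∫|ω|²` (operator norm ≤ Frobenius norm, `div v = 0`)
  have hDZ : ∫ x, ‖fderiv ℝ v x‖ ^ 2 ≤ ∫ x, ‖om x‖ ^ 2 := by
    have h1 : ENNReal.ofReal (∫ x, ‖fderiv ℝ v x‖ ^ 2) ≤ ENNReal.ofReal (∫ x, ‖om x‖ ^ 2) := by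
      rw [ofReal_integral_eq_lintegral_ofReal i_D (Eventually.of_forall fun x => sq_nonneg _),
        ofReal_integral_eq_lintegral_ofReal i_Z (Eventually.of_forall fun x => sq_nonneg _)]
      calc ∫⁻ x, ENNReal.ofReal (‖fderiv ℝ v x‖ ^ 2)
          ≤ ∫⁻ x, ENNReal.ofReal (frobeniusNormSq (fderiv ℝ v x)) :=
            lintegral_mono fun x => ENNReal.ofReal_le_ofReal (sq_opNorm_le_frobeniusNormSq _)
        _ ≤ ∫⁻ x, ‖om x‖ₑ ^ 2 :=
            lintegral_frobeniusNormSq_fderiv_le_lintegral_sq_norm_curl (hv.of_le (by norm_cast)) hdiv hL2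
        _ = ∫⁻ x, ENNReal.ofReal (‖om x‖ ^ 2) :=
            lintegral_congr fun x => by rw [← ofReal_norm, ENNReal.ofReal_pow (norm_nonneg _)]
    exact (ENNReal.ofReal_le_ofReal_iff (integral_nonneg fun x => sq_nonneg _)).1 h1
  -- pointwise: `2⟪ω, (∇v)ω⟫ ≤ (N₁+N₂)(‖∇v‖² + 3|ω|²)`
  have hpt : ∀ x, 2 * ⟪om x, fderiv ℝ v x (om x)⟫ ≤ Ns * (‖fderiv ℝ v x‖ ^ 2 + 3 * ‖om x‖ ^ 2) := by
    intro x
    have h1 : ⟪om x, fderiv ℝ v x (om x)⟫ ≤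
        (‖G (k + 1) x‖ + ‖G (k + 2) x‖) * (‖fderiv ℝ v x‖ * ‖om x‖ + ‖om x‖ ^ 2) :=
      (le_abs_self _).trans (abs_inner_curlCLM_apply_le_two_rows (fderiv ℝ v x) k)
    have h2 : ‖G (k + 1) x‖ + ‖G (k + 2) x‖ ≤ Ns := add_le_add (hGN _ x) (hGN _ x)
    have hD0 : 0 ≤ ‖fderiv ℝ v x‖ := norm_nonneg _
    have hw0 : 0 ≤ ‖om x‖ := norm_nonneg _
    have h3 : (‖G (k + 1) x‖ + ‖G (k + 2) x‖) * (‖fderiv ℝ v x‖ * ‖om x‖ + ‖om x‖ ^ 2) ≤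
        Ns * (‖fderiv ℝ v x‖ * ‖om x‖ + ‖om x‖ ^ 2) :=
      mul_le_mul_of_nonneg_right h2 (by positivity)
    nlinarith [h1, h3, sq_nonneg (‖fderiv ℝ v x‖ - ‖om x‖), hNs0]
  have hI : Integrable (fun x => Ns * (‖fderiv ℝ v x‖ ^ 2 + 3 * ‖om x‖ ^ 2)) volume :=
    (i_D.add (i_Z.const_mul _)).const_mul _
  have hle : ∫ x, 2 * ⟪om x, fderiv ℝ v x (om x)⟫ ≤ ∫ x, Ns * (‖fderiv ℝ v x‖ ^ 2 + 3 * ‖om x‖ ^ 2) := by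
    by_cases hS : Integrable (fun x => 2 * ⟪om x, fderiv ℝ v x (om x)⟫) volume
    · exact integral_mono hS hI hpt
    · rw [integral_undef hS]
      exact integral_nonneg fun x => by positivity
  have hI1 : ∫ x, 2 * ⟪om x, fderiv ℝ v x (om x)⟫ = 2 * ∫ x, ⟪om x, fderiv ℝ v x (om x)⟫ :=
    integral_const_mul _ _
  have hI2 : ∫ x, Ns * (‖fderiv ℝ v x‖ ^ 2 + 3 * ‖om x‖ ^ 2) =
      Ns * ((∫ x, ‖fderiv ℝ v x‖ ^ 2) + 3 * ∫ x, ‖om x‖ ^ 2) := by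
    rw [integral_const_mul, integral_add i_D (i_Z.const_mul _), integral_const_mul]
  rw [hI1, hI2] at hle
  have hZ0 : 0 ≤ ∫ x, ‖om x‖ ^ 2 := integral_nonneg fun x => sq_nonneg _
  nlinarith [hle, hDZ, hZ0, hNs0, mul_nonneg hNs0 hZ0,
    mul_le_mul_of_nonneg_left hDZ hNs0]

set_option maxHeartbeats 1600000 in
/-- **Two velocity-component gradients in `L¹(0,T; L^∞)`: continuation** (Fan–Gao 2009,
Thm. 1.1 (1.5) with `r = 0`, `Ẋ₀ = M(L², L²) = L^∞`; the endpoint `α = 1`, `γ = ∞` of the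
scaling `2/α + 3/γ = 2`). For a classical unforced solution on `ℝ³ × [0, T)` in the
Beale–Kato–Majda class: if `∇u_j ∈ L¹(0,T; L^∞(ℝ³))` for the two indices `j ≠ k`, the solution
continues in the class past `T`: the weight `4(‖∇u_{k+1}(t)‖_∞ + ‖∇u_{k+2}(t)‖_∞)` is integrable
(and time-measurable: the `L^∞` norm of a continuous slice is a supremum over a countable
dense set), `two_mul_integral_stretching_le_of_two_velocity_gradients_top`, the slab Grönwall
inequality and the `H¹` continuation. [cite: FanGao2009EJDE, Thm. 1.1 (1.5) with `r = 0` (p. 2); Tao2011, Lemma 8.1] -/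
theorem fanGao_two_velocity_gradients_criterion_top {ν : ℝ} (hν : 0 < ν) {T : ℝ} (hT : 0 < T)
    {u : ℝ → (EuclideanSpace ℝ (Fin 3)) → (EuclideanSpace ℝ (Fin 3))}
    {p : ℝ → (EuclideanSpace ℝ (Fin 3)) → ℝ}
    (hsol : IsClassicalNSSolutionOn (Ico 0 T) ν 0 u p)
    (hreg : ∀ T'' < T, HasBoundedSobolevNormsOn (Icc 0 T'') u) (k : Fin 3)
    (hG : ∀ j, j ≠ k → MemLqLp 1 ⊤
      (fun t x => (EuclideanSpace.proj j : EuclideanSpace ℝ (Fin 3) →L[ℝ] ℝ).comp (fderiv ℝ (u t) x))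
      (Ioo 0 T)) :
    HasSobolevExtensionPast ν u T := by
  obtain ⟨Ce, hCetop, hTao⟩ := tao_finite_energy_smooth_energy_bound_holds
  -- the time weights
  set N : Fin 3 → ℝ → ℝ := fun j t => (eLpNorm (fun x => (EuclideanSpace.proj j :
    EuclideanSpace ℝ (Fin 3) →L[ℝ] ℝ).comp (fderiv ℝ (u t) x)) ⊤ volume).toReal with hN
  have hN0 : ∀ j t, 0 ≤ N j t := fun j t => ENNReal.toReal_nonneg
  have hI1 := lintegral_ofReal_toReal_lt_top_fg (hG (k + 1) (fin3_add_one_ne_fg k))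
  have hI2 := lintegral_ofReal_toReal_lt_top_fg (hG (k + 2) (fin3_add_two_ne_fg k))
  set I₁ : ℝ≥0∞ := ∫⁻ t in Ioo 0 T, ENNReal.ofReal (N (k + 1) t) with hI₁
  set I₂ : ℝ≥0∞ := ∫⁻ t in Ioo 0 T, ENNReal.ofReal (N (k + 2) t) with hI₂
  have hI₁top : I₁ < ⊤ := hI1
  have hI₂top : I₂ < ⊤ := hI2
  set a : ℝ → ℝ := fun t => 4 * (N (k + 1) t + N (k + 2) t) with ha
  have ha0 : ∀ t, 0 ≤ a t := fun t => by positivity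
  set Aw : ℝ := 4 * (I₁ + I₂).toReal with hAw
  have hAw0 : 0 ≤ Aw := by positivity
  have haE : ∀ t, ENNReal.ofReal (a t) =
      4 * (ENNReal.ofReal (N (k + 1) t) + ENNReal.ofReal (N (k + 2) t)) := by
    intro t
    rw [ha]; dsimp only
    rw [ENNReal.ofReal_mul (by norm_num), ENNReal.ofReal_add (hN0 _ _) (hN0 _ _),
      ENNReal.ofReal_ofNat]
  have hNmeas : ∀ j, AEMeasurable (fun t => ENNReal.ofReal (N j t)) (volume.restrict (Ioo 0 T)) := by
    intro j
    have hE := aemeasurable_eLpNorm_top_proj_fderiv_fg hsol j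
    exact ENNReal.measurable_ofReal.comp_aemeasurable (ENNReal.measurable_toReal.comp_aemeasurable hE)
  have hAint : ∀ T'' ≤ T, ∫⁻ t in Ioo 0 T'', ENNReal.ofReal (a t) ≤ ENNReal.ofReal Aw := by
    intro T'' hT''
    calc ∫⁻ t in Ioo 0 T'', ENNReal.ofReal (a t)
        ≤ ∫⁻ t in Ioo 0 T, ENNReal.ofReal (a t) := lintegral_mono_set (Ioo_subset_Ioo le_rfl hT'')
      _ = ∫⁻ t in Ioo 0 T, 4 * (ENNReal.ofReal (N (k + 1) t) + ENNReal.ofReal (N (k + 2) t)) :=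
          lintegral_congr fun t => haE t
      _ = 4 * (I₁ + I₂) := by
          rw [lintegral_const_mul' _ _ (by norm_num), lintegral_add_left' (hNmeas (k + 1))]
      _ = ENNReal.ofReal Aw := by
          rw [hAw, ENNReal.ofReal_mul (by norm_num), ENNReal.ofReal_ofNat, ENNReal.ofReal_toReal]
          exact (ENNReal.add_lt_top.2 ⟨hI₁top, hI₂top⟩).ne
  -- the initial energy and enstrophy
  have hreg0 : HasBoundedSobolevNormsOn (Icc 0 (T / 2)) u := hreg (T / 2) (by linarith)
  have h00 : (0 : ℝ) ∈ Icc 0 (T / 2) := ⟨le_rfl, by linarith⟩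
  set E₀ : ℝ≥0∞ := ∫⁻ x, ‖u 0 x‖ₑ ^ 2 with hE₀
  have hE₀top : E₀ < ⊤ := by
    obtain ⟨C0, hC0'⟩ := hreg0 0
    refine lt_of_le_of_lt (le_of_eq (lintegral_congr fun x => ?_)) ((hC0' 0 h00).trans_lt ENNReal.coe_lt_top)
    rw [← ofReal_norm, ← ofReal_norm, norm_iteratedFDeriv_zero]
  have hCE : Ce * E₀ < ⊤ := ENNReal.mul_lt_top hCetop hE₀top
  set Ē : ℝ := (Ce * E₀).toReal with hĒ
  have hĒ0 : 0 ≤ Ē := ENNReal.toReal_nonneg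
  set Y₀ : ℝ := ∫ x, ‖curl (u 0) x‖ ^ 2 with hY₀
  have hY₀0 : 0 ≤ Y₀ := integral_nonneg fun x => sq_nonneg _
  set Ystar : ℝ := Y₀ * Real.exp Aw with hYstar
  have hYstar0 : 0 ≤ Ystar := by positivity
  refine hasSobolevExtensionPast_of_uniform_H1_bound hν hT hsol hreg (A := Ē + Ystar)
    (by positivity) ?_
  intro t ht
  -- a closed slab containing `t`
  set T'' : ℝ := (t + T) / 2 with hT''def
  have htT'' : t < T'' := by rw [hT''def]; linarith [ht.2]
  have hT''T : T'' < T := by rw [hT''def]; linarith [ht.2]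
  have hT''pos : 0 < T'' := lt_of_le_of_lt ht.1 htT''
  have hS : IsClassicalNSSolutionOn (Icc 0 T'') ν 0 u p :=
    hsol.mono (Icc_subset_Ico_right hT''T) (uniqueDiffOn_Icc hT''pos)
  have hB : HasBoundedSobolevNormsOn (Icc 0 T'') u := hreg T'' hT''T
  have htS : t ∈ Icc 0 T'' := ⟨ht.1, htT''.le⟩
  have hsm : ∀ s ∈ Icc 0 T'', ContDiff ℝ ∞ (u s) := fun s hs => hS.contDiff_velocity hs
  have hsm3 : ∀ s ∈ Icc 0 T'', ContDiff ℝ 3 (u s) := fun s hs => (hsm s hs).of_le (by norm_cast)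
  have hfin : ∀ n, ∀ s ∈ Icc 0 T'', ∫⁻ x, ‖iteratedFDeriv ℝ n (u s) x‖ₑ ^ 2 < ⊤ := fun n s hs => by
    obtain ⟨Cn, hCn⟩ := hB n
    exact (hCn s hs).trans_lt ENNReal.coe_lt_top
  obtain ⟨B₁, hB₁0, hB₁⟩ := exists_forall_norm_fderiv_le_of_hasBoundedSobolevNormsOn hsm3 hB
  -- Tao's energy class on the slab
  have hfe : ∃ A : ℝ≥0∞, A < ⊤ ∧ ∀ s ∈ Icc 0 T'', ∫⁻ x, ‖u s x‖ₑ ^ 2 ≤ A := by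
    obtain ⟨C0, hC0'⟩ := hB 0
    refine ⟨C0, ENNReal.coe_lt_top, fun s hs => ?_⟩
    refine le_trans (le_of_eq (lintegral_congr fun x => ?_)) (hC0' s hs)
    rw [← ofReal_norm, ← ofReal_norm, norm_iteratedFDeriv_zero]
  obtain ⟨hen, -⟩ := hTao ν T'' hν hT''pos u p hS hfe
  have hen' : ∀ s ∈ Icc 0 T'', ∫⁻ x, ‖u s x‖ₑ ^ 2 ≤ ENNReal.ofReal Ē := fun s hs => by
    rw [hĒ, ENNReal.ofReal_toReal hCE.ne]
    exact hen s hs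
  -- the stretching estimate at every time of the slab
  have hstrS : ∀ᵐ s ∂(volume.restrict (Ioo 0 T'')),
      2 * ∫ x, ⟪curl (u s) x, fderiv ℝ (u s) x (curl (u s) x)⟫ ≤
        ν * (∫ x, frobeniusNormSq (fderiv ℝ (curl (u s)) x)) + a s * (∫ x, ‖curl (u s) x‖ ^ 2) := by
    rw [ae_restrict_iff' measurableSet_Ioo]
    refine Eventually.of_forall fun s hsI => ?_
    have hsS : s ∈ Icc 0 T'' := ⟨hsI.1.le, hsI.2.le⟩
    have h := two_mul_integral_stretching_le_of_two_velocity_gradients_top k (u s) (hsm s hsS)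
      (hS.divFree s hsS) ((hen' s hsS).trans_lt ENNReal.ofReal_lt_top) (hB₁ s hsS) (hfin 1 s hsS)
    have hR0 : 0 ≤ ∫ x, frobeniusNormSq (fderiv ℝ (curl (u s)) x) :=
      integral_nonneg fun x => frobeniusNormSq_nonneg _
    have hadef : 4 * ((eLpNorm (fun x => (EuclideanSpace.proj (k + 1) :
        EuclideanSpace ℝ (Fin 3) →L[ℝ] ℝ).comp (fderiv ℝ (u s) x)) ⊤ volume).toReal +
        (eLpNorm (fun x => (EuclideanSpace.proj (k + 2) :
        EuclideanSpace ℝ (Fin 3) →L[ℝ] ℝ).comp (fderiv ℝ (u s) x)) ⊤ volume).toReal) = a s := rfl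
    rw [hadef] at h
    nlinarith [h, hR0, hν]
  -- the enstrophy bound on the slab
  have hY := integral_sq_norm_curl_le_mul_exp_of_weight_slab_ae hν hT''pos hS hB ha0 hAw0
    (hAint T'' hT''T.le) hstrS t htS
  have hYstar_le : ∫ x, ‖curl (u t) x‖ ^ 2 ≤ Ystar := hY
  -- the `H¹` quantity
  have hvt : ContDiff ℝ ∞ (u t) := hS.contDiff_velocity htS
  have hcurl_int : Integrable fun x => ‖curl (u t) x‖ ^ 2 := by
    refine integrable_sq_norm_of_lintegral_lt_top (continuous_curl (hvt.of_le (by norm_cast))) ?_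
    exact lt_of_le_of_lt (lintegral_curl_sq_le (u t)) (ENNReal.mul_lt_top ENNReal.ofReal_lt_top (hfin 1 t htS))
  have hdc : ∫⁻ x, ENNReal.ofReal (frobeniusNormSq (fderiv ℝ (u t) x)) ≤ ENNReal.ofReal Ystar := by
    refine (lintegral_frobeniusNormSq_fderiv_le_lintegral_sq_norm_curl
      (hvt.of_le (by norm_cast)) (hS.divFree t htS)
      ((hen' t htS).trans_lt ENNReal.ofReal_lt_top)).trans ?_
    rw [show (∫⁻ x, ‖curl (u t) x‖ₑ ^ 2) = ∫⁻ x, ENNReal.ofReal (‖curl (u t) x‖ ^ 2) from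
      lintegral_congr fun x => by rw [← ofReal_norm, ENNReal.ofReal_pow (norm_nonneg _)],
      ← ofReal_integral_eq_lintegral_ofReal hcurl_int (Eventually.of_forall fun x => sq_nonneg _)]
    exact ENNReal.ofReal_le_ofReal hYstar_le
  calc (∫⁻ x, ‖u t x‖ₑ ^ 2) + (∫⁻ x, ENNReal.ofReal (frobeniusNormSq (fderiv ℝ (u t) x)))
      ≤ ENNReal.ofReal Ē + ENNReal.ofReal Ystar := add_le_add (hen' t htS) hdc
    _ = ENNReal.ofReal (Ē + Ystar) := (ENNReal.ofReal_add hĒ0 hYstar0).symm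

/-- **The endpoint `γ = ∞` with `2/α ≤ 2`**: gradients of two velocity components in
`L^α(0,T; L^∞)` for some `1 ≤ α ≤ ∞` give continuation (Hölder in time to `α = 1`,
`MemLqLp.of_exponent_le` with `aemeasurable_eLpNorm_top_proj_fderiv_fg`). [cite: FanGao2009EJDE, Thm. 1.1 (1.5) with `r = 0` and Remark 1.2 (p. 2)] -/
theorem fanGao_two_velocity_gradients_criterion_top_of_le {ν : ℝ} (hν : 0 < ν) {T : ℝ}
    (hT : 0 < T)
    {u : ℝ → (EuclideanSpace ℝ (Fin 3)) → (EuclideanSpace ℝ (Fin 3))}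
    {p : ℝ → (EuclideanSpace ℝ (Fin 3)) → ℝ}
    (hsol : IsClassicalNSSolutionOn (Ico 0 T) ν 0 u p)
    (hreg : ∀ T'' < T, HasBoundedSobolevNormsOn (Icc 0 T'') u) {α : ℝ≥0∞} (h1α : 1 ≤ α) (k : Fin 3)
    (hG : ∀ j, j ≠ k → MemLqLp α ⊤
      (fun t x => (EuclideanSpace.proj j : EuclideanSpace ℝ (Fin 3) →L[ℝ] ℝ).comp (fderiv ℝ (u t) x))
      (Ioo 0 T)) :
    HasSobolevExtensionPast ν u T := by
  refine fanGao_two_velocity_gradients_criterion_top hν hT hsol hreg k fun j hj => ?_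
  refine (hG j hj).of_exponent_le h1α measure_Ioo_lt_top.ne ?_
  exact (ENNReal.measurable_toReal.comp_aemeasurable
    (aemeasurable_eLpNorm_top_proj_fderiv_fg hsol j)).aestronglyMeasurable


end Literature.Analysis.FluidPDE
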